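import Literature.NumberTheory.Sieve.BombieriFriedlanderIwaniecTheorem5Reduction
import HarnessLib

/-!
# Bombieri–Friedlander–Iwaniec 1986, Theorem 5 — step 4: the ranges (12.3)–(12.5) and Theorem 5 from Lemma 9

Topic `Literature/NumberTheory/Sieve`; last file of the formalisation of the provable part of the
proof of Theorem 5 of E. Bombieri, J. B. Friedlander, H. Iwaniec, *Primes in arithmetic
progressions to large moduli*, Acta Math. 156 (1986), 203–251, §12 (pp. 235–237), after
`…Theorem5Weights` (smoothing, (12.1)), `…Theorem5Poisson` (Poisson summation per modulus) and
`…Theorem5Reduction` (separation of variables, Cauchy's inequality, the sum `𝓔`, the structural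
form of (12.2)).  Everything here is PROVED; no named facts are introduced.  The one input of §12
that is NOT proved in the tree is BFI's Lemma 9 (the bound for `𝓔`, "this easily follows from
Lemma 6", i.e. from Lemma 1 = Deshouillers–Iwaniec's bounds for sums of Kloosterman sums,
Invent. Math. 70 (1982), Theorem 12); it enters the final theorem as an explicit hypothesis,
stated verbatim for `BFI.dispE`.

## Contents

* Bookkeeping in the regime of §12 (`x ≥ 1`, `MN = x`, `x^ε ≤ N ≤ x^{1−ε}`, `1/2 ≤ Q, R`,
  `QR < x`, `ε₁ = ε/10`, `Y = M x^{−ε₁}`, `H₀ = ⌊x^{2ε₁} QR/M⌋`, `j ≍ 2/ε₁`,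
  `K(d) = ⌊d x^{ε₁/2}/Y⌋`, divisor bound `τ(n) ≤ C₀ n^ν` with `ν(2B+4) ≤ ε₁/4`):
  `BFI.sum_abs_le_sqrt_mul` (`∑|β_n| ≤ (3N)^{1/2}‖β‖`, with `BFI.card_dyadic_le` of `…TrivialBound`),
  `BFI.sum_dyadic_sigma_rpow_le_x`,
  `BFI.sum_dyadic_sigma_rpow_div_le_x` (`∑_{q∼Q} τ(q)^s(/q) ≪ x^{ε₁/4}(Q)`),
  `BFI.tailBound_H0_le` (the Poisson tail beyond `H₀` is `≤ 32 K_j x⁻¹`),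
  `BFI.divisor_error_le` (the coprimality error per divisor is `≤ 86 K_j x^{3ε₁/2}`),
  `BFI.poisson_errors_le`, `BFI.smoothing_term_le` (`≪ ∑|β_n| M x^{−ε₁/2}`),
  `BFI.sigma_transition_le`, `BFI.sum_sq_gamma_le`, `BFI.delta_ratio_le`.
* **`BFI.abs_dispD_one_le_asymptotic`** — (12.2) with powers of `x`:
  `|𝒟| ≤ C‖β‖x^{1/2−ε/20}M^{1/2} + C x^{3ε/80} ‖β‖ (M/(Q^{1/2}R)) E^{1/2}` for every bound `E` of
  `𝓔(2Q, 2N, H₀, 2R; δ')` over `|δ'| ≤ 1`.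
* `BFI.lemma9Rhs` (the right-hand side of Lemma 9) and **`BFI.lemma9Rhs_le`** — the range
  computation of p. 236–237: under (12.5) (with `x^ε`, `ε = 10ε₁`) and `H₀ ≥ 1`,
  `lemma9Rhs(2Q,2N,H₀,2R,ε₁/40) ≤ 1500 x^{1−ε₁} QR²/M` (so that the `E`-term of (12.2) is
  `≪ ‖β‖ x^{1/2−ε₁/8} M^{1/2}`; the source's four conditions `x^εQ < M`, `x^εQR⁴ < xM`,
  `x^εQR² < M²`, `x^εQ³R⁴ < x²M` are exactly what is used).
* `BFI.theorem5_of_dispE_bound` — Theorem 5 from ANY bound `𝓔(2Q,2N,H₀,2R;δ') ≤ K x^{1−ε₁}QR²/M`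
  valid in the range (12.5) (the end of §12 with the input for `𝓔` abstracted), and
  **`BombieriFriedlanderIwaniecTheorem5_of_lemma9`** — Lemma 9 (as printed, for all `a ≠ 0`,
  `ε > 0`, `C, D, H, R ≥ 1`, all `|δ| ≤ 1`) implies the named fact
  `BombieriFriedlanderIwaniecTheorem5` (with the saving `ε' = min(ε,1)/80`).

## What remains for `BombieriFriedlanderIwaniecTheorem5_holds`

Exactly BFI's Lemma 9.  Its reduction to Lemma 6 (p. 236, the reciprocity step
`𝓔 ≤ 𝒜(D,C,1,H,R) + O(…)`) is proved in the sequel `…Theorem5Reciprocity`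
(`BombieriFriedlanderIwaniecTheorem5_of_lemma6`); Lemma 6 (p. 227, from Lemma 1 by squaring out
and the diagonal count) and Lemma 1 itself = Deshouillers–Iwaniec 1982, Theorem 12 (Kuznetsov's
formula and the spectral theory of `Γ₀(rs)∖ℍ`) are in neither Mathlib nor the tree.

## References

* E. Bombieri, J. B. Friedlander, H. Iwaniec, Acta Math. 156 (1986), 203–251, §12 pp. 235–237,
  Lemma 9 p. 236, Theorem 5 p. 237. [BombieriFriedlanderIwaniecActa1986]
-/

noncomputable section

open Finset Real MeasureTheory
open scoped ArithmeticFunction.sigma ContDiff FourierTransform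

namespace Literature.NumberTheory.Sieve

namespace BFI

/-- `∑_{n∼N} |β_n| ≤ (#{n∼N})^{1/2} ‖β‖` (Cauchy–Schwarz). [folklore] -/
theorem sum_abs_le_sqrt_card_mul (N : ℝ) (β : ℕ → ℝ) :
    ∑ n ∈ dyadic N, |β n| ≤ Real.sqrt (#(dyadic N)) * Real.sqrt (l2Sq N β) := by
  have hCS := Finset.sum_mul_sq_le_sq_mul_sq (dyadic N) (fun _ => (1 : ℝ)) (fun n => |β n|)
  simp only [one_mul, one_pow, Finset.sum_const, nsmul_eq_mul, mul_one, sq_abs] at hCS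
  have h0 : 0 ≤ ∑ n ∈ dyadic N, |β n| := Finset.sum_nonneg fun n _ => abs_nonneg _
  rw [← Real.sqrt_mul (Nat.cast_nonneg _), l2Sq]
  calc ∑ n ∈ dyadic N, |β n| = Real.sqrt ((∑ n ∈ dyadic N, |β n|) ^ 2) := (Real.sqrt_sq h0).symm
    _ ≤ Real.sqrt (#(dyadic N) * ∑ n ∈ dyadic N, β n ^ 2) := Real.sqrt_le_sqrt hCS

/-- `∑_{n∼N} |β_n| ≤ (3N)^{1/2} ‖β‖` for `N ≥ 1`. [folklore] -/
theorem sum_abs_le_sqrt_mul {N : ℝ} (hN : 1 ≤ N) (β : ℕ → ℝ) :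
    ∑ n ∈ dyadic N, |β n| ≤ Real.sqrt (3 * N) * Real.sqrt (l2Sq N β) := by
  refine (sum_abs_le_sqrt_card_mul N β).trans (mul_le_mul_of_nonneg_right ?_ (Real.sqrt_nonneg _))
  refine Real.sqrt_le_sqrt ((card_dyadic_le (by linarith)).trans (by linarith))

/-- `∑_{q∼Q} 1/q ≤ 4` for `Q ≥ 1/2` (at most `2Q + 1` terms, each `< 1/Q ≤ 2`… precisely each
`≤ 1/q < 1/Q` and `(2Q+1)/Q ≤ 4`). [folklore] -/
theorem sum_dyadic_inv_le {Q : ℝ} (hQ : 1 / 2 ≤ Q) : ∑ q ∈ dyadic Q, (1 : ℝ) / q ≤ 4 := by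
  have hQ0 : 0 < Q := by linarith
  calc ∑ q ∈ dyadic Q, (1 : ℝ) / q ≤ ∑ q ∈ dyadic Q, 1 / Q := by
        refine Finset.sum_le_sum fun q hq => ?_
        have h := ((mem_dyadic hQ0.le).1 hq).1
        exact one_div_le_one_div_of_le hQ0 h.le
    _ = #(dyadic Q) * (1 / Q) := by rw [Finset.sum_const, nsmul_eq_mul]
    _ ≤ (2 * Q + 1) * (1 / Q) :=
        mul_le_mul_of_nonneg_right (card_dyadic_le hQ0.le) (by positivity)
    _ = 2 + 1 / Q := by field_simp
    _ ≤ 4 := by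
        have : 1 / Q ≤ 2 := by rw [div_le_iff₀ hQ0]; linarith
        linarith

/-- **Divisor-power sums over a dyadic range through the divisor bound**: if `τ(n) ≤ C₀ n^η` for
all `n ≥ 1` (`C₀ ≥ 1`, `η ≥ 0`), then for `Q ≥ 1/2` and real `s ≥ 0`,
`∑_{q∼Q} τ(q)^s/q ≤ 4 C₀^s (2Q)^{ηs}`. [folklore] -/
theorem sum_dyadic_sigma_rpow_div_le {C₀ η : ℝ} (hC₀ : 1 ≤ C₀) (hη : 0 ≤ η)
    (hτ : ∀ n : ℕ, n ≠ 0 → ((σ 0 n : ℕ) : ℝ) ≤ C₀ * (n : ℝ) ^ η) {Q : ℝ} (hQ : 1 / 2 ≤ Q) {s : ℝ}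
    (hs : 0 ≤ s) :
    ∑ q ∈ dyadic Q, (σ 0 q : ℝ) ^ s / q ≤ 4 * C₀ ^ s * (2 * Q) ^ (η * s) := by
  have hQ0 : 0 < Q := by linarith
  have hterm : ∀ q ∈ dyadic Q, (σ 0 q : ℝ) ^ s / q ≤ C₀ ^ s * (2 * Q) ^ (η * s) * (1 / q) := by
    intro q hq
    obtain ⟨hq1, hq2⟩ := (mem_dyadic hQ0.le).1 hq
    have hq0 : 0 < q := pos_of_mem_dyadic hQ0.le hq
    have h1 : (σ 0 q : ℝ) ≤ C₀ * (q : ℝ) ^ η := hτ q hq0.ne'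
    have h2 : (σ 0 q : ℝ) ^ s ≤ (C₀ * (2 * Q) ^ η) ^ s := by
      refine Real.rpow_le_rpow (by positivity) (h1.trans ?_) hs
      exact mul_le_mul_of_nonneg_left (Real.rpow_le_rpow (by positivity) hq2 hη) (by linarith)
    rw [Real.mul_rpow (by linarith) (by positivity), ← Real.rpow_mul (by positivity)] at h2
    rw [div_eq_mul_one_div]
    exact mul_le_mul_of_nonneg_right h2 (by positivity)
  calc ∑ q ∈ dyadic Q, (σ 0 q : ℝ) ^ s / q
      ≤ ∑ q ∈ dyadic Q, C₀ ^ s * (2 * Q) ^ (η * s) * (1 / q) := Finset.sum_le_sum hterm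
    _ = C₀ ^ s * (2 * Q) ^ (η * s) * ∑ q ∈ dyadic Q, (1 : ℝ) / q := by rw [Finset.mul_sum]
    _ ≤ C₀ ^ s * (2 * Q) ^ (η * s) * 4 :=
        mul_le_mul_of_nonneg_left (sum_dyadic_inv_le hQ) (by positivity)
    _ = _ := by ring

/-- Same for `∑_{q∼Q} τ(q)^s ≤ 4Q · C₀^s (2Q)^{ηs}` (`Q ≥ 1/2`, at most `2Q+1 ≤ 4Q` terms). [folklore] -/
theorem sum_dyadic_sigma_rpow_le {C₀ η : ℝ} (hC₀ : 1 ≤ C₀) (hη : 0 ≤ η)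
    (hτ : ∀ n : ℕ, n ≠ 0 → ((σ 0 n : ℕ) : ℝ) ≤ C₀ * (n : ℝ) ^ η) {Q : ℝ} (hQ : 1 / 2 ≤ Q) {s : ℝ}
    (hs : 0 ≤ s) :
    ∑ q ∈ dyadic Q, (σ 0 q : ℝ) ^ s ≤ 4 * Q * (C₀ ^ s * (2 * Q) ^ (η * s)) := by
  have hQ0 : 0 < Q := by linarith
  have hterm : ∀ q ∈ dyadic Q, (σ 0 q : ℝ) ^ s ≤ C₀ ^ s * (2 * Q) ^ (η * s) := by
    intro q hq
    obtain ⟨hq1, hq2⟩ := (mem_dyadic hQ0.le).1 hq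
    have hq0 : 0 < q := pos_of_mem_dyadic hQ0.le hq
    have h1 : (σ 0 q : ℝ) ≤ C₀ * (q : ℝ) ^ η := hτ q hq0.ne'
    have h2 : (σ 0 q : ℝ) ^ s ≤ (C₀ * (2 * Q) ^ η) ^ s := by
      refine Real.rpow_le_rpow (by positivity) (h1.trans ?_) hs
      exact mul_le_mul_of_nonneg_left (Real.rpow_le_rpow (by positivity) hq2 hη) (by linarith)
    rwa [Real.mul_rpow (by linarith) (by positivity), ← Real.rpow_mul (by positivity)] at h2
  calc ∑ q ∈ dyadic Q, (σ 0 q : ℝ) ^ s ≤ ∑ q ∈ dyadic Q, C₀ ^ s * (2 * Q) ^ (η * s) :=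
        Finset.sum_le_sum hterm
    _ = #(dyadic Q) * (C₀ ^ s * (2 * Q) ^ (η * s)) := by rw [Finset.sum_const, nsmul_eq_mul]
    _ ≤ (2 * Q + 1) * (C₀ ^ s * (2 * Q) ^ (η * s)) :=
        mul_le_mul_of_nonneg_right (card_dyadic_le hQ0.le) (by positivity)
    _ ≤ 4 * Q * (C₀ ^ s * (2 * Q) ^ (η * s)) :=
        mul_le_mul_of_nonneg_right (by linarith) (by positivity)

/-- `𝓔 = 0` when the `h`-range is empty (`⌊H⌋ = 0`). [folklore] -/
theorem dispE_eq_zero_of_floor {a : ℤ} {C D H R : ℝ} (hH : ⌊H⌋₊ = 0) (δ : ℕ → ℕ → ℂ) :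
    dispE a C D H R δ = 0 := by
  unfold dispE
  refine Finset.sum_eq_zero fun c _ => Finset.sum_eq_zero fun d _ => ?_
  rw [hH, Finset.Icc_eq_empty_of_lt (by norm_num : (0 : ℕ) < 1), Finset.sum_empty, norm_zero,
    zero_pow two_ne_zero]


/-! ### The tail bound in the regime of §12 -/

/-- `tailBound Y j k K = 16 K_j · Y(K+1) · (k/(2πY(K+1)))ʲ` (`Y > 0`, `j ≥ 1`). [folklore] -/
theorem tailBound_eq {Y : ℝ} (hY : 0 < Y) {j : ℕ} (hj : 1 ≤ j) (k K : ℕ) :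
    tailBound Y j k K =
      16 * derivConst j * (Y * ((K : ℝ) + 1)) * ((k : ℝ) / (2 * π * Y * ((K : ℝ) + 1))) ^ j := by
  unfold tailBound
  have hK : (0 : ℝ) < (K : ℝ) + 1 := by positivity
  obtain ⟨i, rfl⟩ : ∃ i, j = i + 1 := ⟨j - 1, by omega⟩
  rw [Nat.add_sub_cancel]
  have hπ : (0 : ℝ) < 2 * π := by positivity
  have e1 : (k : ℝ) / (2 * π * Y * ((K : ℝ) + 1)) = (k : ℝ) / (2 * π) * Y⁻¹ * ((K : ℝ) + 1)⁻¹ := by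
    field_simp
  have e2 : ((K : ℝ) + 1) * (((K : ℝ) + 1)⁻¹) ^ (i + 1) = (((K : ℝ) + 1) ^ i)⁻¹ := by
    rw [pow_succ, ← inv_pow, ← mul_assoc, mul_comm ((K : ℝ) + 1), mul_assoc,
      mul_inv_cancel₀ hK.ne', mul_one]
  rw [e1, mul_pow, mul_pow, ← e2]
  ring

/-- If `k/(2πY(K+1)) ≤ θ` then `tailBound Y j k K ≤ 16 K_j Y (K+1) θʲ`. [folklore] -/
theorem tailBound_le_of {Y θ : ℝ} (hY : 0 < Y) {j : ℕ} (hj : 1 ≤ j) {k K : ℕ}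
    (hθ : (k : ℝ) / (2 * π * Y * ((K : ℝ) + 1)) ≤ θ) :
    tailBound Y j k K ≤ 16 * derivConst j * (Y * ((K : ℝ) + 1)) * θ ^ j := by
  rw [tailBound_eq hY hj]
  have h1 := one_le_derivConst j
  have hu : 0 ≤ (k : ℝ) / (2 * π * Y * ((K : ℝ) + 1)) := by positivity
  exact mul_le_mul_of_nonneg_left (pow_le_pow_left₀ hu hθ j) (by positivity)

/-- **The tail beyond `H₀ = ⌊x^{2ε₁}QR/M⌋` at a modulus `k ≤ 4QR`**: with `Y = M x^{−ε₁}` and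
`jε₁ ≥ 2 + 2ε₁`, `tailBound Y j k H₀ ≤ 32 K_j x⁻¹` (for `x ≥ 1`, `1 ≤ M ≤ x`, `QR < x`).
[cite: BombieriFriedlanderIwaniecActa1986, §12 p. 236] -/
theorem tailBound_H0_le {x M Q R ε₁ : ℝ} (hx : 1 ≤ x) (hM1 : 1 ≤ M) (hMx : M ≤ x) (hQ : 0 < Q)
    (hR : 0 < R) (hQR : Q * R < x) (hε₁ : 0 < ε₁) {j : ℕ} (hj : 1 ≤ j) (hjε : 2 + 2 * ε₁ ≤ j * ε₁)
    {k : ℕ} (hk : (k : ℝ) ≤ 4 * Q * R) :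
    tailBound (M * x ^ (-ε₁)) j k ⌊x ^ (2 * ε₁) * Q * R / M⌋₊ ≤ 32 * derivConst j * x⁻¹ := by
  have hx0 : 0 < x := by linarith
  have hM0 : 0 < M := by linarith
  set Y : ℝ := M * x ^ (-ε₁) with hYdef
  have hY : 0 < Y := by positivity
  set H : ℝ := x ^ (2 * ε₁) * Q * R / M with hHdef
  have hH0 : 0 ≤ H := by positivity
  set H₀ : ℕ := ⌊H⌋₊ with hH₀def
  have hH₁ : H < (H₀ : ℝ) + 1 := Nat.lt_floor_add_one H
  have hKj := one_le_derivConst j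
  -- the ratio `k/(2πY(H₀+1)) ≤ x^{-ε₁}`
  have hθ : (k : ℝ) / (2 * π * Y * ((H₀ : ℝ) + 1)) ≤ x ^ (-ε₁) := by
    rw [div_le_iff₀ (by positivity)]
    have h1 : (k : ℝ) ≤ 4 * Q * R := hk
    have h2 : 4 * Q * R ≤ x ^ (-ε₁) * (2 * π * Y * H) := by
      rw [hYdef, hHdef]
      have hπ3 : (3 : ℝ) ≤ π := by linarith [Real.pi_gt_three]
      have e : x ^ (-ε₁) * (2 * π * (M * x ^ (-ε₁)) * (x ^ (2 * ε₁) * Q * R / M)) =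
          2 * π * Q * R * (x ^ (-ε₁) * x ^ (-ε₁) * x ^ (2 * ε₁)) := by
        field_simp
      rw [e, ← Real.rpow_add hx0, ← Real.rpow_add hx0,
        show -ε₁ + -ε₁ + 2 * ε₁ = 0 by ring, Real.rpow_zero, mul_one]
      nlinarith [mul_pos hQ hR]
    have h3 : x ^ (-ε₁) * (2 * π * Y * H) ≤ x ^ (-ε₁) * (2 * π * Y * ((H₀ : ℝ) + 1)) := by
      gcongr
    linarith
  refine (tailBound_le_of hY hj hθ).trans ?_
  -- `Y (H₀ + 1) ≤ Y (H + 1) = x^{ε₁} Q R + Y ≤ 2 x^{1+ε₁}` and `(x^{-ε₁})^j ≤ x^{-2-2ε₁}`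
  have hYH : Y * ((H₀ : ℝ) + 1) ≤ 2 * x ^ (1 + ε₁) := by
    have hfl : (H₀ : ℝ) ≤ H := Nat.floor_le hH0
    calc Y * ((H₀ : ℝ) + 1) ≤ Y * (H + 1) := by gcongr
      _ = x ^ (-ε₁) * x ^ (2 * ε₁) * (Q * R) + M * x ^ (-ε₁) := by
          rw [hYdef, hHdef]; field_simp
      _ ≤ x ^ ε₁ * x + x * 1 := by
          rw [← Real.rpow_add hx0, show -ε₁ + 2 * ε₁ = ε₁ by ring]
          refine add_le_add (mul_le_mul_of_nonneg_left hQR.le (by positivity)) ?_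
          exact mul_le_mul hMx (Real.rpow_le_one_of_one_le_of_nonpos hx (by linarith))
            (by positivity) (by linarith)
      _ = x ^ (1 + ε₁) + x := by
          rw [Real.rpow_add hx0, Real.rpow_one]; ring
      _ ≤ 2 * x ^ (1 + ε₁) := by
          have : x ≤ x ^ (1 + ε₁) := by
            calc x = x ^ (1 : ℝ) := (Real.rpow_one x).symm
              _ ≤ x ^ (1 + ε₁) := Real.rpow_le_rpow_of_exponent_le hx (by linarith)
          linarith
  have hθj : (x ^ (-ε₁)) ^ j ≤ x ^ (-(2 + 2 * ε₁)) := by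
    rw [← Real.rpow_natCast, ← Real.rpow_mul hx0.le]
    refine Real.rpow_le_rpow_of_exponent_le hx ?_
    nlinarith
  calc 16 * derivConst j * (Y * ((H₀ : ℝ) + 1)) * (x ^ (-ε₁)) ^ j
      ≤ 16 * derivConst j * (2 * x ^ (1 + ε₁)) * x ^ (-(2 + 2 * ε₁)) := by
        gcongr
    _ = 32 * derivConst j * (x ^ (1 + ε₁) * x ^ (-(2 + 2 * ε₁))) := by ring
    _ = 32 * derivConst j * x ^ (-(1 + ε₁)) := by
        rw [← Real.rpow_add hx0, show 1 + ε₁ + -(2 + 2 * ε₁) = -(1 + ε₁) by ring]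
    _ ≤ 32 * derivConst j * x⁻¹ := by
        rw [← Real.rpow_neg_one]
        exact mul_le_mul_of_nonneg_left (Real.rpow_le_rpow_of_exponent_le hx (by linarith))
          (by positivity)


/-- **The coprimality error per divisor** `d ≤ 4x`: with `Y = Mx^{−ε₁}`, `K(d) = ⌊d x^{ε₁/2}/Y⌋`
and `jε₁ ≥ 2 + 2ε₁`: `d⁻¹ (2K(d)(M + 2Y) + tailBound Y j d K(d)) ≤ 86 K_j x^{3ε₁/2}`.
[cite: BombieriFriedlanderIwaniecActa1986, §12 p. 236] -/
theorem divisor_error_le {x M ε₁ : ℝ} (hx : 1 ≤ x) (hM1 : 1 ≤ M) (hMx : M ≤ x) (hε₁ : 0 < ε₁)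
    {j : ℕ} (hj : 1 ≤ j) (hjε : 2 + 2 * ε₁ ≤ j * ε₁) {d : ℕ} (hd : 0 < d) (hdx : (d : ℝ) ≤ 4 * x) :
    (d : ℝ)⁻¹ * (2 * (⌊(d : ℝ) * x ^ (ε₁ / 2) / (M * x ^ (-ε₁))⌋₊ : ℕ) * (M + 2 * (M * x ^ (-ε₁))) +
        tailBound (M * x ^ (-ε₁)) j d ⌊(d : ℝ) * x ^ (ε₁ / 2) / (M * x ^ (-ε₁))⌋₊) ≤
      86 * derivConst j * x ^ (3 * ε₁ / 2) := by
  have hx0 : 0 < x := by linarith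
  have hM0 : 0 < M := by linarith
  have hd0 : (0 : ℝ) < d := by exact_mod_cast hd
  set Y : ℝ := M * x ^ (-ε₁) with hYdef
  have hY : 0 < Y := by positivity
  have hYM : Y ≤ M := by
    rw [hYdef]
    exact mul_le_of_le_one_right hM0.le (Real.rpow_le_one_of_one_le_of_nonpos hx (by linarith))
  set Kr : ℝ := (d : ℝ) * x ^ (ε₁ / 2) / Y with hKrdef
  have hKr0 : 0 ≤ Kr := by positivity
  set Kd : ℕ := ⌊Kr⌋₊ with hKddef
  have hKd1 : Kr < (Kd : ℝ) + 1 := Nat.lt_floor_add_one Kr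
  have hKdle : (Kd : ℝ) ≤ Kr := Nat.floor_le hKr0
  have hKj := one_le_derivConst j
  -- the tail part
  have hθ : (d : ℝ) / (2 * π * Y * ((Kd : ℝ) + 1)) ≤ x ^ (-(ε₁ / 2)) := by
    rw [div_le_iff₀ (by positivity)]
    have hπ3 : (3 : ℝ) ≤ π := by linarith [Real.pi_gt_three]
    have h1 : (d : ℝ) = x ^ (-(ε₁ / 2)) * (Y * Kr) := by
      rw [hKrdef, mul_div_cancel₀ _ hY.ne', ← mul_assoc, mul_comm (x ^ (-(ε₁ / 2))), mul_assoc,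
        ← Real.rpow_add hx0, show -(ε₁ / 2) + ε₁ / 2 = 0 by ring, Real.rpow_zero, mul_one]
    have h2 : Y * Kr ≤ 2 * π * Y * ((Kd : ℝ) + 1) := by nlinarith [mul_pos hY (by positivity : (0:ℝ) < (Kd:ℝ) + 1)]
    rw [h1]
    exact mul_le_mul_of_nonneg_left h2 (by positivity)
  have hTB : tailBound Y j d Kd ≤ 80 * derivConst j := by
    refine (tailBound_le_of hY hj hθ).trans ?_
    have hYK : Y * ((Kd : ℝ) + 1) ≤ 5 * x ^ (1 + ε₁ / 2) := by
      calc Y * ((Kd : ℝ) + 1) ≤ Y * (Kr + 1) := by gcongr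
        _ = (d : ℝ) * x ^ (ε₁ / 2) + Y := by rw [hKrdef]; field_simp
        _ ≤ 4 * x * x ^ (ε₁ / 2) + x * 1 := by
            refine add_le_add (mul_le_mul_of_nonneg_right hdx (by positivity)) ?_
            rw [mul_one]; exact hYM.trans hMx
        _ = 4 * x ^ (1 + ε₁ / 2) + x := by rw [Real.rpow_add hx0, Real.rpow_one]; ring
        _ ≤ 5 * x ^ (1 + ε₁ / 2) := by
            have : x ≤ x ^ (1 + ε₁ / 2) := by
              calc x = x ^ (1 : ℝ) := (Real.rpow_one x).symm
                _ ≤ x ^ (1 + ε₁ / 2) := Real.rpow_le_rpow_of_exponent_le hx (by linarith)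
            linarith
    have hθj : (x ^ (-(ε₁ / 2))) ^ j ≤ x ^ (-(1 + ε₁)) := by
      rw [← Real.rpow_natCast, ← Real.rpow_mul hx0.le]
      refine Real.rpow_le_rpow_of_exponent_le hx ?_
      nlinarith
    calc 16 * derivConst j * (Y * ((Kd : ℝ) + 1)) * (x ^ (-(ε₁ / 2))) ^ j
        ≤ 16 * derivConst j * (5 * x ^ (1 + ε₁ / 2)) * x ^ (-(1 + ε₁)) := by gcongr
      _ = 80 * derivConst j * (x ^ (1 + ε₁ / 2) * x ^ (-(1 + ε₁))) := by ring
      _ = 80 * derivConst j * x ^ (-(ε₁ / 2)) := by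
          rw [← Real.rpow_add hx0]; congr 2; ring
      _ ≤ 80 * derivConst j * 1 := by
          gcongr
          exact Real.rpow_le_one_of_one_le_of_nonpos hx (by linarith)
      _ = 80 * derivConst j := by ring
  -- the `K(d)` part
  have hK : 2 * (Kd : ℝ) * (M + 2 * Y) ≤ 6 * (d : ℝ) * x ^ (3 * ε₁ / 2) := by
    have h1 : (Kd : ℝ) * Y ≤ (d : ℝ) * x ^ (ε₁ / 2) := by
      calc (Kd : ℝ) * Y ≤ Kr * Y := mul_le_mul_of_nonneg_right hKdle hY.le
        _ = (d : ℝ) * x ^ (ε₁ / 2) := by rw [hKrdef]; field_simp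
    have h2 : M + 2 * Y ≤ 3 * M := by linarith
    have h3 : (Kd : ℝ) * M = (Kd : ℝ) * Y * x ^ ε₁ := by
      rw [hYdef, mul_assoc, mul_assoc, ← Real.rpow_add hx0, show -ε₁ + ε₁ = 0 by ring,
        Real.rpow_zero, mul_one]
    calc 2 * (Kd : ℝ) * (M + 2 * Y) ≤ 2 * (Kd : ℝ) * (3 * M) := by gcongr
      _ = 6 * ((Kd : ℝ) * Y * x ^ ε₁) := by rw [← h3]; ring
      _ ≤ 6 * ((d : ℝ) * x ^ (ε₁ / 2) * x ^ ε₁) := by gcongr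
      _ = 6 * (d : ℝ) * x ^ (3 * ε₁ / 2) := by
          rw [mul_assoc (d : ℝ), ← Real.rpow_add hx0]; ring_nf
  -- combine
  have hx3 : (1 : ℝ) ≤ x ^ (3 * ε₁ / 2) := Real.one_le_rpow hx (by positivity)
  calc (d : ℝ)⁻¹ * (2 * (Kd : ℝ) * (M + 2 * Y) + tailBound Y j d Kd)
      ≤ (d : ℝ)⁻¹ * (6 * (d : ℝ) * x ^ (3 * ε₁ / 2) + 80 * derivConst j) := by gcongr
    _ = 6 * x ^ (3 * ε₁ / 2) + 80 * derivConst j * (d : ℝ)⁻¹ := by field_simp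
    _ ≤ 6 * derivConst j * x ^ (3 * ε₁ / 2) + 80 * derivConst j * x ^ (3 * ε₁ / 2) := by
        refine add_le_add ?_ ?_
        · refine mul_le_mul_of_nonneg_right ?_ (by positivity); linarith
        · refine mul_le_mul_of_nonneg_left ?_ (by positivity)
          have : (d : ℝ)⁻¹ ≤ 1 := inv_le_one_of_one_le₀ (by exact_mod_cast hd)
          linarith
    _ = 86 * derivConst j * x ^ (3 * ε₁ / 2) := by ring


/-! ### Divisor sums in the regime `1/2 ≤ Q ≤ 2x` -/

/-- `(c x)^t ≤ c x^t` for `c ≥ 1`, `x ≥ 1`, `t ≤ 1`. [folklore] -/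
theorem const_mul_rpow_le {c x t : ℝ} (hc : 1 ≤ c) (hx : 1 ≤ x) (ht1 : t ≤ 1) :
    (c * x) ^ t ≤ c * x ^ t := by
  rw [Real.mul_rpow (by linarith) (by linarith)]
  refine mul_le_mul_of_nonneg_right ?_ (by positivity)
  calc c ^ t ≤ c ^ (1 : ℝ) := Real.rpow_le_rpow_of_exponent_le hc ht1
    _ = c := Real.rpow_one c

/-- `(2Q)^{u} ≤ 4 x^{ε₁/4}` for `Q ≤ 2x`, `x ≥ 1`, `0 ≤ u ≤ ε₁/4 ≤ 1`. [folklore] -/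
theorem two_mul_rpow_le {Q x u ε₁ : ℝ} (hQ : 0 < Q) (hQx : Q ≤ 2 * x) (hx : 1 ≤ x) (hu0 : 0 ≤ u)
    (hu : u ≤ ε₁ / 4) (hε₁ : ε₁ ≤ 4) : (2 * Q) ^ u ≤ 4 * x ^ (ε₁ / 4) := by
  calc (2 * Q) ^ u ≤ (4 * x) ^ u := Real.rpow_le_rpow (by positivity) (by linarith) hu0
    _ ≤ (4 * x) ^ (ε₁ / 4) := Real.rpow_le_rpow_of_exponent_le (by linarith) hu
    _ ≤ 4 * x ^ (ε₁ / 4) := const_mul_rpow_le (by norm_num) hx (by linarith)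

/-- `∑_{q∼Q} τ(q)^s ≤ 16 C₀^s Q x^{ε₁/4}` in the regime (divisor bound with exponent `ν`,
`νs ≤ ε₁/4`). [folklore] -/
theorem sum_dyadic_sigma_rpow_le_x {C₀ ν : ℝ} (hC₀ : 1 ≤ C₀) (hν : 0 ≤ ν)
    (hτ : ∀ n : ℕ, n ≠ 0 → ((σ 0 n : ℕ) : ℝ) ≤ C₀ * (n : ℝ) ^ ν) {Q x ε₁ s : ℝ} (hQ : 1 / 2 ≤ Q)
    (hQx : Q ≤ 2 * x) (hx : 1 ≤ x) (hs : 0 ≤ s) (hνs : ν * s ≤ ε₁ / 4) (hε₁ : ε₁ ≤ 4) :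
    ∑ q ∈ dyadic Q, (σ 0 q : ℝ) ^ s ≤ 16 * C₀ ^ s * Q * x ^ (ε₁ / 4) := by
  have hQ0 : 0 < Q := by linarith
  refine (sum_dyadic_sigma_rpow_le hC₀ hν hτ hQ hs).trans ?_
  have h := two_mul_rpow_le hQ0 hQx hx (by positivity) hνs hε₁
  calc 4 * Q * (C₀ ^ s * (2 * Q) ^ (ν * s)) ≤ 4 * Q * (C₀ ^ s * (4 * x ^ (ε₁ / 4))) := by gcongr
    _ = _ := by ring

/-- `∑_{q∼Q} τ(q)^s/q ≤ 16 C₀^s x^{ε₁/4}` in the regime. [folklore] -/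
theorem sum_dyadic_sigma_rpow_div_le_x {C₀ ν : ℝ} (hC₀ : 1 ≤ C₀) (hν : 0 ≤ ν)
    (hτ : ∀ n : ℕ, n ≠ 0 → ((σ 0 n : ℕ) : ℝ) ≤ C₀ * (n : ℝ) ^ ν) {Q x ε₁ s : ℝ} (hQ : 1 / 2 ≤ Q)
    (hQx : Q ≤ 2 * x) (hx : 1 ≤ x) (hs : 0 ≤ s) (hνs : ν * s ≤ ε₁ / 4) (hε₁ : ε₁ ≤ 4) :
    ∑ q ∈ dyadic Q, (σ 0 q : ℝ) ^ s / q ≤ 16 * C₀ ^ s * x ^ (ε₁ / 4) := by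
  have hQ0 : 0 < Q := by linarith
  refine (sum_dyadic_sigma_rpow_div_le hC₀ hν hτ hQ hs).trans ?_
  have h := two_mul_rpow_le hQ0 hQx hx (by positivity) hνs hε₁
  calc 4 * C₀ ^ s * (2 * Q) ^ (ν * s) ≤ 4 * C₀ ^ s * (4 * x ^ (ε₁ / 4)) := by gcongr
    _ = _ := by ring

/-- **The Poisson tails and the coprimality errors, summed over the moduli** (the error terms
`O(Q⁻¹R⁻¹)` and `O(Q⁻¹R⁻¹τ(qr))` of BFI p. 236 summed with the weights `τ(q)^B τ(r)^B`): in the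
regime of §12 the double sum of `abs_dispD_one_le_structural` is `≤ 30208 K_j C₀^{2B+4} x^{2ε₁}`.
[cite: BombieriFriedlanderIwaniecActa1986, §12 p. 236] -/
theorem poisson_errors_le {C₀ ν : ℝ} (hC₀ : 1 ≤ C₀) (hν : 0 ≤ ν)
    (hτ : ∀ n : ℕ, n ≠ 0 → ((σ 0 n : ℕ) : ℝ) ≤ C₀ * (n : ℝ) ^ ν) {x M Q R ε₁ B : ℝ} (hx : 1 ≤ x)
    (hM1 : 1 ≤ M) (hMx : M ≤ x) (hQ : 1 / 2 ≤ Q) (hQx : Q ≤ 2 * x) (hR : 1 / 2 ≤ R)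
    (hRx : R ≤ 2 * x) (hQR : Q * R < x) (hε₁ : 0 < ε₁) (hε₁1 : ε₁ ≤ 1) (hB : 0 ≤ B)
    (hνB : ν * (2 * B + 4) ≤ ε₁ / 4) {j : ℕ} (hj : 1 ≤ j) (hjε : 2 + 2 * ε₁ ≤ j * ε₁) :
    ∑ q ∈ dyadic Q, ∑ r ∈ dyadic R, (σ 0 q : ℝ) ^ B * (σ 0 r : ℝ) ^ B *
        ((((q * r : ℕ) : ℝ))⁻¹ * tailBound (M * x ^ (-ε₁)) j (q * r) ⌊x ^ (2 * ε₁) * Q * R / M⌋₊ +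
          (∑ d ∈ (q * r).divisors, (d : ℝ)⁻¹ *
              (2 * (⌊(d : ℝ) * x ^ (ε₁ / 2) / (M * x ^ (-ε₁))⌋₊ : ℕ) * (M + 2 * (M * x ^ (-ε₁))) +
                tailBound (M * x ^ (-ε₁)) j d ⌊(d : ℝ) * x ^ (ε₁ / 2) / (M * x ^ (-ε₁))⌋₊)) /
            (Nat.totient (q * r) : ℝ)) ≤
      30208 * derivConst j * C₀ ^ (2 * B + 4) * x ^ (2 * ε₁) := by
  have hx0 : 0 < x := by linarith
  have hQ0 : 0 < Q := by linarith
  have hR0 : 0 < R := by linarith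
  have hKj := one_le_derivConst j
  set W : ℝ := 86 * derivConst j * x ^ (3 * ε₁ / 2) with hW
  have hW0 : 0 ≤ W := by positivity
  -- per modulus
  have hterm : ∀ q ∈ dyadic Q, ∀ r ∈ dyadic R,
      (σ 0 q : ℝ) ^ B * (σ 0 r : ℝ) ^ B *
        ((((q * r : ℕ) : ℝ))⁻¹ * tailBound (M * x ^ (-ε₁)) j (q * r) ⌊x ^ (2 * ε₁) * Q * R / M⌋₊ +
          (∑ d ∈ (q * r).divisors, (d : ℝ)⁻¹ *
              (2 * (⌊(d : ℝ) * x ^ (ε₁ / 2) / (M * x ^ (-ε₁))⌋₊ : ℕ) * (M + 2 * (M * x ^ (-ε₁))) +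
                tailBound (M * x ^ (-ε₁)) j d ⌊(d : ℝ) * x ^ (ε₁ / 2) / (M * x ^ (-ε₁))⌋₊)) /
            (Nat.totient (q * r) : ℝ)) ≤
        (σ 0 q : ℝ) ^ B * (σ 0 r : ℝ) ^ B * (32 * derivConst j * x⁻¹) +
          (σ 0 q : ℝ) ^ (B + 2) / q * ((σ 0 r : ℝ) ^ (B + 2) / r) * W := by
    intro q hq r hr
    have hq0 : 0 < q := pos_of_mem_dyadic hQ0.le hq
    have hr0 : 0 < r := pos_of_mem_dyadic hR0.le hr
    have hq2 := ((mem_dyadic hQ0.le).1 hq).2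
    have hr2 := ((mem_dyadic hR0.le).1 hr).2
    have hk : 0 < q * r := Nat.mul_pos hq0 hr0
    have hσq : (1 : ℝ) ≤ (σ 0 q : ℝ) := by exact_mod_cast one_le_sigma_zero hq0.ne'
    have hσr : (1 : ℝ) ≤ (σ 0 r : ℝ) := by exact_mod_cast one_le_sigma_zero hr0.ne'
    have hkle : ((q * r : ℕ) : ℝ) ≤ 4 * Q * R := by
      push_cast
      calc (q : ℝ) * r ≤ (2 * Q) * (2 * R) := mul_le_mul hq2 hr2 (by positivity) (by positivity)
        _ = 4 * Q * R := by ring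
    -- first part
    have hA : (((q * r : ℕ) : ℝ))⁻¹ * tailBound (M * x ^ (-ε₁)) j (q * r) ⌊x ^ (2 * ε₁) * Q * R / M⌋₊ ≤
        32 * derivConst j * x⁻¹ := by
      have h1 := tailBound_H0_le hx hM1 hMx hQ0 hR0 hQR hε₁ hj hjε hkle
      have h2 : (((q * r : ℕ) : ℝ))⁻¹ ≤ 1 := inv_le_one_of_one_le₀ (by exact_mod_cast hk)
      have h3 := tailBound_nonneg (by positivity : 0 < M * x ^ (-ε₁)) j (q * r) ⌊x ^ (2 * ε₁) * Q * R / M⌋₊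
      calc (((q * r : ℕ) : ℝ))⁻¹ * tailBound (M * x ^ (-ε₁)) j (q * r) ⌊x ^ (2 * ε₁) * Q * R / M⌋₊
          ≤ 1 * (32 * derivConst j * x⁻¹) := mul_le_mul h2 h1 h3 (by linarith)
        _ = _ := one_mul _
    -- second part
    have hBsum : ∑ d ∈ (q * r).divisors, (d : ℝ)⁻¹ *
        (2 * (⌊(d : ℝ) * x ^ (ε₁ / 2) / (M * x ^ (-ε₁))⌋₊ : ℕ) * (M + 2 * (M * x ^ (-ε₁))) +
          tailBound (M * x ^ (-ε₁)) j d ⌊(d : ℝ) * x ^ (ε₁ / 2) / (M * x ^ (-ε₁))⌋₊) ≤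
        (σ 0 q : ℝ) * (σ 0 r : ℝ) * W := by
      calc ∑ d ∈ (q * r).divisors, (d : ℝ)⁻¹ *
            (2 * (⌊(d : ℝ) * x ^ (ε₁ / 2) / (M * x ^ (-ε₁))⌋₊ : ℕ) * (M + 2 * (M * x ^ (-ε₁))) +
              tailBound (M * x ^ (-ε₁)) j d ⌊(d : ℝ) * x ^ (ε₁ / 2) / (M * x ^ (-ε₁))⌋₊)
          ≤ ∑ d ∈ (q * r).divisors, W := by
            refine Finset.sum_le_sum fun d hd => ?_
            have hd0 : 0 < d := Nat.pos_of_mem_divisors hd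
            have hdle : d ≤ q * r := Nat.divisor_le hd
            have hdx : (d : ℝ) ≤ 4 * x := by
              have : (d : ℝ) ≤ ((q * r : ℕ) : ℝ) := by exact_mod_cast hdle
              nlinarith [mul_pos hQ0 hR0]
            exact divisor_error_le hx hM1 hMx hε₁ hj hjε hd0 hdx
        _ = (σ 0 (q * r) : ℝ) * W := by
            rw [Finset.sum_const, nsmul_eq_mul, ArithmeticFunction.sigma_zero_apply]
        _ ≤ (σ 0 q : ℝ) * (σ 0 r : ℝ) * W := by
            refine mul_le_mul_of_nonneg_right ?_ hW0
            exact_mod_cast sigma_zero_mul_le q r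
    have hB2 : (∑ d ∈ (q * r).divisors, (d : ℝ)⁻¹ *
        (2 * (⌊(d : ℝ) * x ^ (ε₁ / 2) / (M * x ^ (-ε₁))⌋₊ : ℕ) * (M + 2 * (M * x ^ (-ε₁))) +
          tailBound (M * x ^ (-ε₁)) j d ⌊(d : ℝ) * x ^ (ε₁ / 2) / (M * x ^ (-ε₁))⌋₊)) /
          (Nat.totient (q * r) : ℝ) ≤
        (σ 0 q : ℝ) * (σ 0 r : ℝ) * W * ((σ 0 q : ℝ) * (σ 0 r : ℝ) / ((q : ℝ) * r)) := by
      rw [div_eq_mul_inv]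
      have hφ : 0 < (Nat.totient (q * r) : ℝ) := by exact_mod_cast Nat.totient_pos.2 hk
      exact mul_le_mul hBsum (inv_totient_mul_le hq0 hr0) (by positivity) (by positivity)
    have e : (σ 0 q : ℝ) ^ B * (σ 0 r : ℝ) ^ B *
        ((σ 0 q : ℝ) * (σ 0 r : ℝ) * W * ((σ 0 q : ℝ) * (σ 0 r : ℝ) / ((q : ℝ) * r))) =
        (σ 0 q : ℝ) ^ (B + 2) / q * ((σ 0 r : ℝ) ^ (B + 2) / r) * W := by
      rw [Real.rpow_add (by linarith), Real.rpow_add (by linarith), Real.rpow_two, Real.rpow_two]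
      field_simp
    calc _ ≤ (σ 0 q : ℝ) ^ B * (σ 0 r : ℝ) ^ B * (32 * derivConst j * x⁻¹ +
          (σ 0 q : ℝ) * (σ 0 r : ℝ) * W * ((σ 0 q : ℝ) * (σ 0 r : ℝ) / ((q : ℝ) * r))) :=
          mul_le_mul_of_nonneg_left (add_le_add hA hB2) (by positivity)
      _ = _ := by rw [mul_add, e]
  -- sum over the moduli
  have hνB' : ν * B ≤ ε₁ / 4 := by nlinarith
  have hνB2 : ν * (B + 2) ≤ ε₁ / 4 := by nlinarith
  have hSQ := sum_dyadic_sigma_rpow_le_x hC₀ hν hτ hQ hQx hx hB hνB' (by linarith)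
  have hSR := sum_dyadic_sigma_rpow_le_x hC₀ hν hτ hR hRx hx hB hνB' (by linarith)
  have hTQ := sum_dyadic_sigma_rpow_div_le_x hC₀ hν hτ hQ hQx hx (by linarith : 0 ≤ B + 2) hνB2
    (by linarith)
  have hTR := sum_dyadic_sigma_rpow_div_le_x hC₀ hν hτ hR hRx hx (by linarith : 0 ≤ B + 2) hνB2
    (by linarith)
  calc _ ≤ ∑ q ∈ dyadic Q, ∑ r ∈ dyadic R, ((σ 0 q : ℝ) ^ B * (σ 0 r : ℝ) ^ B *
        (32 * derivConst j * x⁻¹) + (σ 0 q : ℝ) ^ (B + 2) / q * ((σ 0 r : ℝ) ^ (B + 2) / r) * W) :=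
        Finset.sum_le_sum fun q hq => Finset.sum_le_sum fun r hr => hterm q hq r hr
    _ = 32 * derivConst j * x⁻¹ * ((∑ q ∈ dyadic Q, (σ 0 q : ℝ) ^ B) *
          (∑ r ∈ dyadic R, (σ 0 r : ℝ) ^ B)) +
          W * ((∑ q ∈ dyadic Q, (σ 0 q : ℝ) ^ (B + 2) / q) *
            (∑ r ∈ dyadic R, (σ 0 r : ℝ) ^ (B + 2) / r)) := by
        rw [Finset.sum_mul_sum, Finset.sum_mul_sum, Finset.mul_sum, Finset.mul_sum,
          ← Finset.sum_add_distrib]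
        refine Finset.sum_congr rfl fun q _ => ?_
        rw [Finset.mul_sum, Finset.mul_sum, ← Finset.sum_add_distrib]
        refine Finset.sum_congr rfl fun r _ => ?_
        ring
    _ ≤ 32 * derivConst j * x⁻¹ * ((16 * C₀ ^ B * Q * x ^ (ε₁ / 4)) *
          (16 * C₀ ^ B * R * x ^ (ε₁ / 4))) +
          W * ((16 * C₀ ^ (B + 2) * x ^ (ε₁ / 4)) * (16 * C₀ ^ (B + 2) * x ^ (ε₁ / 4))) := by
        have h0 : 0 ≤ ∑ r ∈ dyadic R, (σ 0 r : ℝ) ^ B := Finset.sum_nonneg fun _ _ => by positivity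
        have h0' : 0 ≤ ∑ r ∈ dyadic R, (σ 0 r : ℝ) ^ (B + 2) / r :=
          Finset.sum_nonneg fun _ _ => by positivity
        have h1 := mul_le_mul hSQ hSR h0 (by positivity)
        have h2 := mul_le_mul hTQ hTR h0' (by positivity)
        exact add_le_add (mul_le_mul_of_nonneg_left h1 (by positivity))
          (mul_le_mul_of_nonneg_left h2 hW0)
    _ = 8192 * derivConst j * C₀ ^ B * C₀ ^ B * (x⁻¹ * (Q * R) * (x ^ (ε₁ / 4) * x ^ (ε₁ / 4))) +
          22016 * derivConst j * (C₀ ^ (B + 2) * C₀ ^ (B + 2)) *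
            (x ^ (3 * ε₁ / 2) * (x ^ (ε₁ / 4) * x ^ (ε₁ / 4))) := by rw [hW]; ring
    _ ≤ 8192 * derivConst j * C₀ ^ (2 * B + 4) * x ^ (2 * ε₁) +
          22016 * derivConst j * C₀ ^ (2 * B + 4) * x ^ (2 * ε₁) := by
        have hC1 : C₀ ^ B * C₀ ^ B ≤ C₀ ^ (2 * B + 4) := by
          rw [← Real.rpow_add (by linarith)]
          exact Real.rpow_le_rpow_of_exponent_le hC₀ (by linarith)
        have hC2 : C₀ ^ (B + 2) * C₀ ^ (B + 2) = C₀ ^ (2 * B + 4) := by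
          rw [← Real.rpow_add (by linarith)]; ring_nf
        have hx1 : x⁻¹ * (Q * R) * (x ^ (ε₁ / 4) * x ^ (ε₁ / 4)) ≤ x ^ (2 * ε₁) := by
          have h1 : x⁻¹ * (Q * R) ≤ 1 := by
            rw [inv_mul_le_iff₀ hx0]; linarith
          have h2 : x ^ (ε₁ / 4) * x ^ (ε₁ / 4) ≤ x ^ (2 * ε₁) := by
            rw [← Real.rpow_add hx0]
            exact Real.rpow_le_rpow_of_exponent_le hx (by linarith)
          calc x⁻¹ * (Q * R) * (x ^ (ε₁ / 4) * x ^ (ε₁ / 4)) ≤ 1 * x ^ (2 * ε₁) :=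
                mul_le_mul h1 h2 (by positivity) (by linarith)
            _ = _ := one_mul _
        have hx2 : x ^ (3 * ε₁ / 2) * (x ^ (ε₁ / 4) * x ^ (ε₁ / 4)) = x ^ (2 * ε₁) := by
          rw [← Real.rpow_add hx0, ← Real.rpow_add hx0]; ring_nf
        rw [hC2, hx2]
        refine add_le_add ?_ le_rfl
        calc 8192 * derivConst j * C₀ ^ B * C₀ ^ B * (x⁻¹ * (Q * R) * (x ^ (ε₁ / 4) * x ^ (ε₁ / 4)))
            = 8192 * derivConst j * (C₀ ^ B * C₀ ^ B) *
                (x⁻¹ * (Q * R) * (x ^ (ε₁ / 4) * x ^ (ε₁ / 4))) := by ring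
          _ ≤ 8192 * derivConst j * C₀ ^ (2 * B + 4) * x ^ (2 * ε₁) := by gcongr
    _ = _ := by ring


/-! ### The smoothing term, the weights `γ`, `δ`, and the divisor bound `D₀` in the regime -/

/-- **The smoothing term (12.1) in the regime**: with `Y = Mx^{−ε₁} ≥ 1` and
`D₀ = C₀ (8x)^ν`, `(2Y+2) β₁ (D₀^{2B+2} + ∑τ^{B+1}/q · ∑τ^{B+1}/r) ≤ 1056 C₀^{2B+2} β₁ M x^{−ε₁/2}`.
[cite: BombieriFriedlanderIwaniecActa1986, §12 (12.1) p. 236] -/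
theorem smoothing_term_le {C₀ ν : ℝ} (hC₀ : 1 ≤ C₀) (hν : 0 ≤ ν)
    (hτ : ∀ n : ℕ, n ≠ 0 → ((σ 0 n : ℕ) : ℝ) ≤ C₀ * (n : ℝ) ^ ν) {x M Q R ε₁ B β₁ : ℝ} (hx : 1 ≤ x)
    (hMε : x ^ ε₁ ≤ M) (hQ : 1 / 2 ≤ Q) (hQx : Q ≤ 2 * x) (hR : 1 / 2 ≤ R)
    (hRx : R ≤ 2 * x) (hε₁ : 0 < ε₁) (hε₁1 : ε₁ ≤ 1) (hB : 0 ≤ B)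
    (hνB : ν * (2 * B + 4) ≤ ε₁ / 4) (hβ₁ : 0 ≤ β₁) :
    (2 * (M * x ^ (-ε₁)) + 2) * β₁ *
        ((C₀ * (8 * x) ^ ν) ^ (2 * B + 2) +
          (∑ q ∈ dyadic Q, (σ 0 q : ℝ) ^ (B + 1) / q) *
            (∑ r ∈ dyadic R, (σ 0 r : ℝ) ^ (B + 1) / r)) ≤
      1056 * C₀ ^ (2 * B + 2) * β₁ * M * x ^ (-(ε₁ / 2)) := by
  have hx0 : 0 < x := by linarith
  have hM0 : 0 < M := lt_of_lt_of_le (by positivity) hMε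
  set Y : ℝ := M * x ^ (-ε₁) with hY
  have hY1 : 1 ≤ Y := by
    rw [hY]
    calc (1 : ℝ) = x ^ ε₁ * x ^ (-ε₁) := by
          rw [← Real.rpow_add hx0, add_neg_cancel, Real.rpow_zero]
      _ ≤ M * x ^ (-ε₁) := mul_le_mul_of_nonneg_right hMε (by positivity)
  have hνB1 : ν * (B + 1) ≤ ε₁ / 4 := by nlinarith
  have hPQ := sum_dyadic_sigma_rpow_div_le_x hC₀ hν hτ hQ hQx hx (by linarith : 0 ≤ B + 1) hνB1
    (by linarith)
  have hPR := sum_dyadic_sigma_rpow_div_le_x hC₀ hν hτ hR hRx hx (by linarith : 0 ≤ B + 1) hνB1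
    (by linarith)
  have hD : (C₀ * (8 * x) ^ ν) ^ (2 * B + 2) ≤ 8 * C₀ ^ (2 * B + 2) * x ^ (ε₁ / 4) := by
    rw [Real.mul_rpow (by linarith) (by positivity), ← Real.rpow_mul (by positivity)]
    have h1 : (8 * x) ^ (ν * (2 * B + 2)) ≤ 8 * x ^ (ε₁ / 4) := by
      calc (8 * x) ^ (ν * (2 * B + 2)) ≤ (8 * x) ^ (ε₁ / 4) :=
            Real.rpow_le_rpow_of_exponent_le (by linarith) (by nlinarith)
        _ ≤ 8 * x ^ (ε₁ / 4) := const_mul_rpow_le (by norm_num) hx (by linarith)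
    calc C₀ ^ (2 * B + 2) * (8 * x) ^ (ν * (2 * B + 2)) ≤ C₀ ^ (2 * B + 2) * (8 * x ^ (ε₁ / 4)) :=
          mul_le_mul_of_nonneg_left h1 (by positivity)
      _ = _ := by ring
  have hP : (∑ q ∈ dyadic Q, (σ 0 q : ℝ) ^ (B + 1) / q) *
      (∑ r ∈ dyadic R, (σ 0 r : ℝ) ^ (B + 1) / r) ≤ 256 * C₀ ^ (2 * B + 2) * x ^ (ε₁ / 2) := by
    have h0 : 0 ≤ ∑ r ∈ dyadic R, (σ 0 r : ℝ) ^ (B + 1) / r :=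
      Finset.sum_nonneg fun _ _ => by positivity
    calc _ ≤ (16 * C₀ ^ (B + 1) * x ^ (ε₁ / 4)) * (16 * C₀ ^ (B + 1) * x ^ (ε₁ / 4)) :=
          mul_le_mul hPQ hPR h0 (by positivity)
      _ = 256 * (C₀ ^ (B + 1) * C₀ ^ (B + 1)) * (x ^ (ε₁ / 4) * x ^ (ε₁ / 4)) := by ring
      _ = 256 * C₀ ^ (2 * B + 2) * x ^ (ε₁ / 2) := by
          rw [← Real.rpow_add (by linarith), ← Real.rpow_add hx0]; ring_nf
  have hsum : (C₀ * (8 * x) ^ ν) ^ (2 * B + 2) +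
      (∑ q ∈ dyadic Q, (σ 0 q : ℝ) ^ (B + 1) / q) *
        (∑ r ∈ dyadic R, (σ 0 r : ℝ) ^ (B + 1) / r) ≤ 264 * C₀ ^ (2 * B + 2) * x ^ (ε₁ / 2) := by
    have h1 : x ^ (ε₁ / 4) ≤ x ^ (ε₁ / 2) := Real.rpow_le_rpow_of_exponent_le hx (by linarith)
    have h2 : 8 * C₀ ^ (2 * B + 2) * x ^ (ε₁ / 4) ≤ 8 * C₀ ^ (2 * B + 2) * x ^ (ε₁ / 2) :=
      mul_le_mul_of_nonneg_left h1 (by positivity)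
    linarith
  have h2Y : 2 * Y + 2 ≤ 4 * Y := by linarith
  calc (2 * Y + 2) * β₁ * ((C₀ * (8 * x) ^ ν) ^ (2 * B + 2) +
        (∑ q ∈ dyadic Q, (σ 0 q : ℝ) ^ (B + 1) / q) * (∑ r ∈ dyadic R, (σ 0 r : ℝ) ^ (B + 1) / r))
      ≤ (4 * Y) * β₁ * (264 * C₀ ^ (2 * B + 2) * x ^ (ε₁ / 2)) := by
        refine mul_le_mul (mul_le_mul_of_nonneg_right h2Y hβ₁) hsum (by positivity) (by positivity)
    _ = 1056 * C₀ ^ (2 * B + 2) * β₁ * M * (x ^ (-ε₁) * x ^ (ε₁ / 2)) := by rw [hY]; ring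
    _ = 1056 * C₀ ^ (2 * B + 2) * β₁ * M * x ^ (-(ε₁ / 2)) := by
        rw [← Real.rpow_add hx0]; ring_nf

/-- **The divisor bound on the transition ranges**: for `m` in `bumpDiffSupport M Y` (`0 ≤ Y ≤ M`),
`n ∼ N`, `MN = x`, `|a| ≤ x`: `τ(mn − a) ≤ C₀ (8x)^ν`. [folklore] -/
theorem sigma_transition_le {C₀ ν : ℝ} (hC₀ : 1 ≤ C₀) (hν : 0 ≤ ν)
    (hτ : ∀ n : ℕ, n ≠ 0 → ((σ 0 n : ℕ) : ℝ) ≤ C₀ * (n : ℝ) ^ ν) {a : ℤ} {x M Y N : ℝ}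
    (hY : 0 ≤ Y) (hYM : Y ≤ M) (hN : 0 ≤ N) (hMN : M * N = x) (hax : (|a| : ℝ) ≤ x)
    {m : ℕ} (hm : m ∈ bumpDiffSupport M Y) {n : ℕ} (hn : n ∈ dyadic N) :
    (σ 0 ((((m * n : ℕ) : ℤ) - a).toNat) : ℝ) ≤ C₀ * (8 * x) ^ ν := by
  have hM : 0 ≤ M := hY.trans hYM
  have hx0 : 0 ≤ x := by rw [← hMN]; positivity
  set l : ℕ := (((m * n : ℕ) : ℤ) - a).toNat with hl
  rcases Nat.eq_zero_or_pos l with h0 | hpos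
  · rw [h0]
    simp only [ArithmeticFunction.map_zero, Nat.cast_zero]
    positivity
  · have hm3 : (m : ℝ) ≤ 3 * M := by
      have hm' : m ≤ ⌊2 * M + Y⌋₊ := by
        rw [bumpDiffSupport, Finset.mem_union, Finset.mem_Ioc, Finset.mem_Ioc] at hm
        rcases hm with ⟨-, h⟩ | ⟨-, h⟩
        · exact h.trans (Nat.floor_mono (by linarith))
        · exact h
      have : (m : ℝ) ≤ 2 * M + Y := by
        calc (m : ℝ) ≤ ⌊2 * M + Y⌋₊ := by exact_mod_cast hm'
          _ ≤ 2 * M + Y := Nat.floor_le (by linarith)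
      linarith
    have hn2 : (n : ℝ) ≤ 2 * N := ((mem_dyadic hN).1 hn).2
    have hlx : (l : ℝ) ≤ 8 * x := by
      have h1 : (l : ℤ) = ((m * n : ℕ) : ℤ) - a := Int.toNat_of_nonneg (by
        have : (0 : ℤ) < l := by exact_mod_cast hpos
        rw [hl] at this
        exact (Int.lt_toNat.1 (by exact_mod_cast hpos)).le)
      have h2 : (l : ℝ) = (m : ℝ) * n - a := by
        have := congrArg (fun z : ℤ => (z : ℝ)) h1
        push_cast at this
        exact this
      rw [h2]
      have h3 : (m : ℝ) * n ≤ 3 * M * (2 * N) := mul_le_mul hm3 hn2 (by positivity) (by positivity)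
      have h4 : -(a : ℝ) ≤ |(a : ℝ)| := neg_le_abs _
      nlinarith
    calc (σ 0 l : ℝ) ≤ C₀ * (l : ℝ) ^ ν := hτ l hpos.ne'
      _ ≤ C₀ * (8 * x) ^ ν := by
          refine mul_le_mul_of_nonneg_left (Real.rpow_le_rpow (by positivity) hlx hν) (by linarith)

/-- `∑_{q∼Q} γ_q² ≤ 16 C₀^{2B} Q x^{ε₁/4}` for `|γ_q| ≤ τ(q)^B` in the regime. [folklore] -/
theorem sum_sq_gamma_le {C₀ ν : ℝ} (hC₀ : 1 ≤ C₀) (hν : 0 ≤ ν)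
    (hτ : ∀ n : ℕ, n ≠ 0 → ((σ 0 n : ℕ) : ℝ) ≤ C₀ * (n : ℝ) ^ ν) {Q x ε₁ B : ℝ} (hQ : 1 / 2 ≤ Q)
    (hQx : Q ≤ 2 * x) (hx : 1 ≤ x) (hB : 0 ≤ B) (hνB : ν * (2 * B + 4) ≤ ε₁ / 4) (hε₁ : ε₁ ≤ 4)
    {γ : ℕ → ℝ} (hγ : ∀ q, |γ q| ≤ (σ 0 q : ℝ) ^ B) :
    ∑ q ∈ dyadic Q, γ q ^ 2 ≤ 16 * C₀ ^ (2 * B) * Q * x ^ (ε₁ / 4) := by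
  have h2B : ν * (2 * B) ≤ ε₁ / 4 := by nlinarith
  refine le_trans (Finset.sum_le_sum fun q _ => ?_)
    (sum_dyadic_sigma_rpow_le_x hC₀ hν hτ hQ hQx hx (by linarith : 0 ≤ 2 * B) h2B hε₁)
  calc γ q ^ 2 = |γ q| ^ 2 := (sq_abs _).symm
    _ ≤ ((σ 0 q : ℝ) ^ B) ^ 2 := pow_le_pow_left₀ (abs_nonneg _) (hγ q) 2
    _ = (σ 0 q : ℝ) ^ (2 * B) := by
        rw [← Real.rpow_natCast, ← Real.rpow_mul (by positivity)]; ring_nf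

/-- `|δ_r| R/r ≤ C₀^B (4x)^{νB}` on `r ∼ R` for `|δ_r| ≤ τ(r)^B`, `R ≤ 2x`. [folklore] -/
theorem delta_ratio_le {C₀ ν : ℝ} (hC₀ : 1 ≤ C₀) (hν : 0 ≤ ν)
    (hτ : ∀ n : ℕ, n ≠ 0 → ((σ 0 n : ℕ) : ℝ) ≤ C₀ * (n : ℝ) ^ ν) {R x B : ℝ} (hR : 0 < R)
    (hRx : R ≤ 2 * x) (hB : 0 ≤ B) {δ : ℕ → ℝ} (hδ : ∀ r, |δ r| ≤ (σ 0 r : ℝ) ^ B) {r : ℕ}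
    (hr : r ∈ dyadic R) : |δ r| * R / r ≤ C₀ ^ B * (4 * x) ^ (ν * B) := by
  obtain ⟨hr1, hr2⟩ := (mem_dyadic hR.le).1 hr
  have hr0 : 0 < r := pos_of_mem_dyadic hR.le hr
  have hr0' : (0 : ℝ) < r := by exact_mod_cast hr0
  have hx0 : 0 < x := by linarith
  calc |δ r| * R / r = |δ r| * (R / r) := by ring
    _ ≤ |δ r| * 1 := by
        refine mul_le_mul_of_nonneg_left ?_ (abs_nonneg _)
        rw [div_le_one hr0']; exact hr1.le
    _ ≤ (σ 0 r : ℝ) ^ B := by rw [mul_one]; exact hδ r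
    _ ≤ (C₀ * (r : ℝ) ^ ν) ^ B := Real.rpow_le_rpow (by positivity) (hτ r hr0.ne') hB
    _ ≤ (C₀ * (4 * x) ^ ν) ^ B := by
        refine Real.rpow_le_rpow (by positivity) ?_ hB
        exact mul_le_mul_of_nonneg_left (Real.rpow_le_rpow (by positivity) (by linarith) hν)
          (by linarith)
    _ = C₀ ^ B * (4 * x) ^ (ν * B) := by
        rw [Real.mul_rpow (by linarith) (by positivity), ← Real.rpow_mul (by positivity)]


/-! ### (12.2) with powers of `x` -/

set_option maxHeartbeats 800000 in
-- a long but elementary assembly of the estimates of this file (raised heartbeat budget)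
/-- **BFI (12.2), asymptotic form** (p. 236: "`𝒟(M,N,Q,R) ≪ ‖β‖ M^{1/2} x^{1/2−ε/2}
+ ‖β‖ x^ε M Q^{−1/2} R⁻¹ 𝓔^{1/2}(2Q, 2N, H, 2R)` (12.2)", with `H = x^ε QR M⁻¹`): for `a ≠ 0`,
`0 < ε ≤ 1`, `B ≥ 0` there are `C, x₀` such that for `x ≥ x₀`, `MN = x`, `x^ε ≤ N ≤ x^{1−ε}`,
`Q, R ≥ 1/2`, `QR < x`, `|γ_q| ≤ τ(q)^B`, `|δ_r| ≤ τ(r)^B` and every `E` bounding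
`𝓔(2Q, 2N, H₀, 2R; δ')` over `|δ'| ≤ 1`, where `H₀ = ⌊x^{ε/5} QR/M⌋`:
`|𝒟(M,N,Q,R; 1, β, γ, δ)| ≤ C ‖β‖ x^{1/2−ε/20} M^{1/2} + C x^{3ε/80} ‖β‖ (M/(Q^{1/2} R)) E^{1/2}`.
(Here `ε₁ = ε/10` plays the rôle of BFI's floating `ε`; PROVED from `abs_dispD_one_le_structural`
with `Y = Mx^{−ε₁}`, `j ≍ 2/ε₁` partial integrations, the divisor bound, and the estimates of this
file.) [cite: BombieriFriedlanderIwaniecActa1986, §12 (12.2) p. 236] -/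
theorem abs_dispD_one_le_asymptotic (a : ℤ) {ε : ℝ} (hε : 0 < ε) (hε1 : ε ≤ 1)
    {B : ℝ} (hB : 0 ≤ B) :
    ∃ C x₀ : ℝ, 0 < C ∧ ∀ x : ℝ, x₀ ≤ x → ∀ M N Q R : ℝ,
      M * N = x → x ^ ε ≤ N → N ≤ x ^ (1 - ε) → 1 / 2 ≤ Q → 1 / 2 ≤ R → Q * R < x →
      ∀ β γ δ : ℕ → ℝ, (∀ q, |γ q| ≤ (σ 0 q : ℝ) ^ B) → (∀ r, |δ r| ≤ (σ 0 r : ℝ) ^ B) →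
      ∀ E : ℝ, (∀ δ' : ℕ → ℕ → ℂ, (∀ h r, ‖δ' h r‖ ≤ 1) →
          dispE a (2 * Q) (2 * N) (⌊x ^ (2 * (ε / 10)) * Q * R / M⌋₊ : ℕ) (2 * R) δ' ≤ E) →
      |dispD a M N Q R (fun _ => 1) β γ δ| ≤
        C * Real.sqrt (l2Sq N β) * x ^ (1 / 2 - ε / 20) * M ^ (1 / 2 : ℝ) +
          C * x ^ (3 * ε / 80) * Real.sqrt (l2Sq N β) * (M / (Real.sqrt Q * R)) * Real.sqrt E := by
  -- fixed parameters
  set ε₁ : ℝ := ε / 10 with hε₁def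
  have hε₁ : 0 < ε₁ := by positivity
  have hε₁1 : ε₁ ≤ 1 := by rw [hε₁def]; linarith
  set ν : ℝ := ε₁ / (4 * (2 * B + 4)) with hνdef
  have hν : 0 < ν := by positivity
  have hνB : ν * (2 * B + 4) ≤ ε₁ / 4 := by
    rw [hνdef]; field_simp; nlinarith
  have hνB' : ν * B ≤ ε₁ / 4 := by nlinarith
  obtain ⟨C₀, hC₀, hτ0⟩ := exists_sigma_zero_le_mul_rpow hν
  have hτ : ∀ n : ℕ, n ≠ 0 → ((σ 0 n : ℕ) : ℝ) ≤ C₀ * (n : ℝ) ^ ν := fun n _ => hτ0 n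
  set j : ℕ := ⌈2 / ε₁⌉₊ + 3 with hjdef
  have hj2 : 2 ≤ j := by omega
  have hj1 : 1 ≤ j := by omega
  have hjε : 2 + 2 * ε₁ ≤ j * ε₁ := by
    have h1 : 2 / ε₁ ≤ ⌈2 / ε₁⌉₊ := Nat.le_ceil _
    have h2 : (j : ℝ) = ⌈2 / ε₁⌉₊ + 3 := by rw [hjdef]; push_cast; ring
    rw [h2, add_mul]
    have h3 : 2 ≤ (⌈2 / ε₁⌉₊ : ℝ) * ε₁ := by
      calc (2 : ℝ) = 2 / ε₁ * ε₁ := by field_simp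
        _ ≤ _ := mul_le_mul_of_nonneg_right h1 hε₁.le
    linarith
  have hKj := one_le_derivConst j
  set C : ℝ := 62528 * derivConst j * C₀ ^ (2 * B + 4) with hCdef
  have hC0 : 0 < C := by positivity
  -- the threshold `x₀`
  have hev : ∀ᶠ x : ℝ in Filter.atTop, 1 ≤ x ∧ 2 ≤ x ^ ε₁ ∧ 2 * (|a| : ℝ) ≤ x ^ ε := by
    refine (Filter.eventually_ge_atTop 1).and (((tendsto_rpow_atTop hε₁).eventually_ge_atTop 2).and
      ((tendsto_rpow_atTop hε).eventually_ge_atTop _))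
  obtain ⟨x₀, hx₀⟩ := Filter.eventually_atTop.1 hev
  refine ⟨C, x₀, hC0, ?_⟩
  intro x hx M N Q R hMN hN1 hN2 hQ hR hQR β γ δ hγ hδ E hE
  obtain ⟨hx1, hxε₁, hxa⟩ := hx₀ x hx
  have hx0 : 0 < x := by linarith
  have hQ0 : 0 < Q := by linarith
  have hR0 : 0 < R := by linarith
  -- size of `M`, `N`, `Q`, `R`
  have hN1' : 1 ≤ N := le_trans (Real.one_le_rpow hx1 hε.le) hN1
  have hN0 : 0 < N := by linarith
  have hMeq : M = x / N := by rw [← hMN]; field_simp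
  have hMε : x ^ ε ≤ M := by
    rw [hMeq, le_div_iff₀ hN0]
    calc x ^ ε * N ≤ x ^ ε * x ^ (1 - ε) := mul_le_mul_of_nonneg_left hN2 (by positivity)
      _ = x := by rw [← Real.rpow_add hx0]; norm_num
  have hM1 : 1 ≤ M := le_trans (Real.one_le_rpow hx1 hε.le) hMε
  have hM0 : 0 < M := by linarith
  have hMx : M ≤ x := by
    rw [hMeq, div_le_iff₀ hN0]
    exact le_mul_of_one_le_right hx0.le hN1'
  have hMε₁ : x ^ ε₁ ≤ M := le_trans (Real.rpow_le_rpow_of_exponent_le hx1 (by linarith)) hMε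
  have hQx : Q ≤ 2 * x := by
    calc Q = Q * 1 := (mul_one Q).symm
      _ ≤ Q * (2 * R) := mul_le_mul_of_nonneg_left (by linarith) hQ0.le
      _ = 2 * (Q * R) := by ring
      _ ≤ 2 * x := by linarith
  have hRx : R ≤ 2 * x := by
    calc R = 1 * R := (one_mul R).symm
      _ ≤ (2 * Q) * R := mul_le_mul_of_nonneg_right (by linarith) hR0.le
      _ = 2 * (Q * R) := by ring
      _ ≤ 2 * x := by linarith
  -- the transition length `Y = M x^{-ε₁}`
  have hY : 0 < M * x ^ (-ε₁) := by positivity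
  have hxε₁' : x ^ (-ε₁) ≤ 1 / 2 := by
    rw [Real.rpow_neg hx0.le, ← one_div]
    exact one_div_le_one_div_of_le (by norm_num) hxε₁
  have hYM2 : M * x ^ (-ε₁) ≤ M / 2 := by
    calc M * x ^ (-ε₁) ≤ M * (1 / 2) := mul_le_mul_of_nonneg_left hxε₁' hM0.le
      _ = M / 2 := by ring
  have hYM : M * x ^ (-ε₁) ≤ M := by linarith
  have ha : (|a| : ℝ) ≤ M - M * x ^ (-ε₁) := by linarith
  have hax : (|a| : ℝ) ≤ x := by linarith
  -- the structural bound
  have hD₀ : 1 ≤ C₀ * (8 * x) ^ ν :=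
    one_le_mul_of_one_le_of_one_le hC₀ (Real.one_le_rpow (by linarith) hν.le)
  obtain ⟨T, hTdef⟩ : ∃ T : ℝ, T = C₀ ^ B * (4 * x) ^ (ν * B) := ⟨_, rfl⟩
  have hT : 0 < T := by rw [hTdef]; positivity
  have hstruct := abs_dispD_one_le_structural (β := β) hY hYM ha hN0.le hQ0 hR0 hB hD₀
    (fun m hm n hn => sigma_transition_le hC₀ hν.le hτ hY.le hYM hN0.le hMN hax hm hn) hγ hδ
    ⌊x ^ (2 * ε₁) * Q * R / M⌋₊ hj2 (fun d : ℕ => ⌊(d : ℝ) * x ^ (ε₁ / 2) / (M * x ^ (-ε₁))⌋₊) hT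
    (fun r hr => by rw [hTdef]; exact delta_ratio_le hC₀ hν.le hτ hR0 hRx hB hδ hr) hE
  -- the three pieces
  have hβ₁0 : 0 ≤ ∑ n ∈ dyadic N, |β n| := Finset.sum_nonneg fun n _ => abs_nonneg _
  have hE1 := smoothing_term_le hC₀ hν.le hτ hx1 hMε₁ hQ hQx hR hRx hε₁ hε₁1 hB hνB hβ₁0
  have hE2 := poisson_errors_le hC₀ hν.le hτ hx1 hM1 hMx hQ hQx hR hRx hQR hε₁ hε₁1 hB hνB hj1 hjε
  have hΓ := sum_sq_gamma_le hC₀ hν.le hτ hQ hQx hx1 hB hνB (by linarith) hγ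
  -- `(∑ n ∈ dyadic N, |β n|) ≤ 2 √N ‖β‖`
  have hβ₁le : (∑ n ∈ dyadic N, |β n|) ≤ 2 * Real.sqrt N * Real.sqrt (l2Sq N β) := by
    refine (sum_abs_le_sqrt_mul hN1' β).trans (mul_le_mul_of_nonneg_right ?_ (Real.sqrt_nonneg _))
    rw [Real.sqrt_le_left (by positivity), mul_pow, Real.sq_sqrt hN0.le]
    linarith
  -- first two pieces together
  have h12 : 1056 * C₀ ^ (2 * B + 2) * (∑ n ∈ dyadic N, |β n|) * M * x ^ (-(ε₁ / 2)) +
      (∑ n ∈ dyadic N, |β n|) * (30208 * derivConst j * C₀ ^ (2 * B + 4) * x ^ (2 * ε₁)) ≤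
      C * Real.sqrt (l2Sq N β) * x ^ (1 / 2 - ε / 20) * M ^ (1 / 2 : ℝ) := by
    -- `x^{2ε₁} ≤ M x^{-ε₁/2}`
    have hx2 : x ^ (2 * ε₁) ≤ M * x ^ (-(ε₁ / 2)) := by
      have h1 : x ^ (2 * ε₁) = x ^ (10 * ε₁) * x ^ (-(8 * ε₁)) := by
        rw [← Real.rpow_add hx0]; ring_nf
      have h2 : x ^ (10 * ε₁) = x ^ ε := by rw [hε₁def]; ring_nf
      rw [h1, h2]
      exact mul_le_mul hMε (Real.rpow_le_rpow_of_exponent_le hx1 (by linarith)) (by positivity)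
        hM0.le
    have hC₀2 : C₀ ^ (2 * B + 2) ≤ C₀ ^ (2 * B + 4) :=
      Real.rpow_le_rpow_of_exponent_le hC₀ (by linarith)
    -- `√N · M · x^{-ε₁/2} = x^{1/2 - ε/20} M^{1/2}`
    have hNM : Real.sqrt N * M * x ^ (-(ε₁ / 2)) = x ^ (1 / 2 - ε / 20) * M ^ (1 / 2 : ℝ) := by
      have e1 : Real.sqrt N * M = x ^ (1 / 2 : ℝ) * M ^ (1 / 2 : ℝ) := by
        rw [Real.sqrt_eq_rpow, ← hMN, Real.mul_rpow hM0.le hN0.le]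
        have hMM : M ^ (1 / 2 : ℝ) * M ^ (1 / 2 : ℝ) = M := by
          rw [← Real.rpow_add hM0]; norm_num
        calc N ^ (1 / 2 : ℝ) * M = N ^ (1 / 2 : ℝ) * (M ^ (1 / 2 : ℝ) * M ^ (1 / 2 : ℝ)) := by
              rw [hMM]
          _ = M ^ (1 / 2 : ℝ) * N ^ (1 / 2 : ℝ) * M ^ (1 / 2 : ℝ) := by ring
      rw [e1, mul_assoc, mul_comm (M ^ (1 / 2 : ℝ)), ← mul_assoc, ← Real.rpow_add hx0]
      congr 2
      rw [hε₁def]; ring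
    calc 1056 * C₀ ^ (2 * B + 2) * (∑ n ∈ dyadic N, |β n|) * M * x ^ (-(ε₁ / 2)) +
          (∑ n ∈ dyadic N, |β n|) * (30208 * derivConst j * C₀ ^ (2 * B + 4) * x ^ (2 * ε₁))
        ≤ 1056 * (derivConst j * C₀ ^ (2 * B + 4)) * (∑ n ∈ dyadic N, |β n|) * M * x ^ (-(ε₁ / 2)) +
          (∑ n ∈ dyadic N, |β n|) * (30208 * derivConst j * C₀ ^ (2 * B + 4) * (M * x ^ (-(ε₁ / 2)))) := by
          have hCC : C₀ ^ (2 * B + 2) ≤ derivConst j * C₀ ^ (2 * B + 4) := by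
            calc C₀ ^ (2 * B + 2) ≤ C₀ ^ (2 * B + 4) := hC₀2
              _ = 1 * C₀ ^ (2 * B + 4) := (one_mul _).symm
              _ ≤ derivConst j * C₀ ^ (2 * B + 4) :=
                  mul_le_mul_of_nonneg_right hKj (by positivity)
          refine add_le_add ?_ ?_
          · refine mul_le_mul_of_nonneg_right (mul_le_mul_of_nonneg_right
              (mul_le_mul_of_nonneg_right ?_ hβ₁0) hM0.le) (by positivity)
            exact mul_le_mul_of_nonneg_left hCC (by norm_num)
          · exact mul_le_mul_of_nonneg_left (mul_le_mul_of_nonneg_left hx2 (by positivity)) hβ₁0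
      _ = 31264 * derivConst j * C₀ ^ (2 * B + 4) * ((∑ n ∈ dyadic N, |β n|) * (M * x ^ (-(ε₁ / 2)))) := by ring
      _ ≤ 31264 * derivConst j * C₀ ^ (2 * B + 4) *
          ((2 * Real.sqrt N * Real.sqrt (l2Sq N β)) * (M * x ^ (-(ε₁ / 2)))) := by
          gcongr
      _ = C * Real.sqrt (l2Sq N β) * (Real.sqrt N * M * x ^ (-(ε₁ / 2))) := by rw [hCdef]; ring
      _ = _ := by rw [hNM]; ring
  -- third piece
  have h3 : 2 * (3 * M / Q * Real.sqrt ((∑ q ∈ dyadic Q, γ q ^ 2) * l2Sq N β) * (T / R) *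
      Real.sqrt E) ≤
      C * x ^ (3 * ε / 80) * Real.sqrt (l2Sq N β) * (M / (Real.sqrt Q * R)) * Real.sqrt E := by
    have hE0 : 0 ≤ E := le_trans (dispE_nonneg _ _ _ _ _ _) (hE (fun _ _ => 0) (fun _ _ => by simp))
    -- `Γ₂ ≤ (4 C₀^B √Q x^{ε₁/8})²`
    obtain ⟨u, hudef⟩ : ∃ u : ℝ, u = 4 * C₀ ^ B * Real.sqrt Q * x ^ (ε₁ / 8) := ⟨_, rfl⟩
    have hu0 : 0 ≤ u := by rw [hudef]; positivity
    have hΓu : ∑ q ∈ dyadic Q, γ q ^ 2 ≤ u ^ 2 := by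
      have e : u ^ 2 = 16 * C₀ ^ (2 * B) * Q * x ^ (ε₁ / 4) := by
        have h1 : (C₀ ^ B) ^ 2 = C₀ ^ (2 * B) := by
          rw [sq, ← Real.rpow_add (by linarith)]; ring_nf
        have h2 : (x ^ (ε₁ / 8)) ^ 2 = x ^ (ε₁ / 4) := by
          rw [sq, ← Real.rpow_add hx0]; ring_nf
        have h3 : Real.sqrt Q ^ 2 = Q := Real.sq_sqrt hQ0.le
        rw [hudef]
        calc (4 * C₀ ^ B * Real.sqrt Q * x ^ (ε₁ / 8)) ^ 2
            = 16 * (C₀ ^ B) ^ 2 * Real.sqrt Q ^ 2 * (x ^ (ε₁ / 8)) ^ 2 := by ring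
          _ = _ := by rw [h1, h2, h3]
      rw [e]
      exact hΓ
    have hsq : Real.sqrt ((∑ q ∈ dyadic Q, γ q ^ 2) * l2Sq N β) ≤ u * Real.sqrt (l2Sq N β) := by
      calc Real.sqrt ((∑ q ∈ dyadic Q, γ q ^ 2) * l2Sq N β)
          ≤ Real.sqrt (u ^ 2 * l2Sq N β) :=
            Real.sqrt_le_sqrt (mul_le_mul_of_nonneg_right hΓu (l2Sq_nonneg N β))
        _ = u * Real.sqrt (l2Sq N β) := by
            rw [Real.sqrt_mul (sq_nonneg u), Real.sqrt_sq hu0]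
    -- `T ≤ 4 C₀^B x^{ε₁/4}`
    have hT4 : T ≤ 4 * C₀ ^ B * x ^ (ε₁ / 4) := by
      rw [hTdef]
      have h1 : (4 * x) ^ (ν * B) ≤ 4 * x ^ (ε₁ / 4) := by
        calc (4 * x) ^ (ν * B) ≤ (4 * x) ^ (ε₁ / 4) :=
              Real.rpow_le_rpow_of_exponent_le (by linarith) hνB'
          _ ≤ 4 * x ^ (ε₁ / 4) := const_mul_rpow_le (by norm_num) hx1 (by linarith)
      calc C₀ ^ B * (4 * x) ^ (ν * B) ≤ C₀ ^ B * (4 * x ^ (ε₁ / 4)) :=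
            mul_le_mul_of_nonneg_left h1 (by positivity)
        _ = _ := by ring
    have hC96 : 96 * C₀ ^ B * C₀ ^ B ≤ C := by
      rw [hCdef, mul_assoc (96 : ℝ), ← Real.rpow_add (by linarith)]
      have h1 : C₀ ^ (B + B) ≤ C₀ ^ (2 * B + 4) := Real.rpow_le_rpow_of_exponent_le hC₀ (by linarith)
      have h96 : (96 : ℝ) ≤ 62528 * derivConst j := by linarith
      exact mul_le_mul h96 h1 (by positivity) (by positivity)
    have hxe : x ^ (ε₁ / 8) * x ^ (ε₁ / 4) = x ^ (3 * ε / 80) := by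
      rw [← Real.rpow_add hx0, hε₁def]; ring_nf
    calc 2 * (3 * M / Q * Real.sqrt ((∑ q ∈ dyadic Q, γ q ^ 2) * l2Sq N β) * (T / R) * Real.sqrt E)
        ≤ 2 * (3 * M / Q * (u * Real.sqrt (l2Sq N β)) * ((4 * C₀ ^ B * x ^ (ε₁ / 4)) / R) *
            Real.sqrt E) := by gcongr
      _ = (96 * C₀ ^ B * C₀ ^ B) * (x ^ (ε₁ / 8) * x ^ (ε₁ / 4)) * Real.sqrt (l2Sq N β) *
            (M * Real.sqrt Q / (Q * R)) * Real.sqrt E := by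
          rw [hudef]; ring
      _ = (96 * C₀ ^ B * C₀ ^ B) * x ^ (3 * ε / 80) * Real.sqrt (l2Sq N β) *
            (M / (Real.sqrt Q * R)) * Real.sqrt E := by
          rw [hxe]
          congr 2
          rw [div_eq_div_iff (by positivity) (by positivity)]
          have hQQ : Real.sqrt Q * Real.sqrt Q = Q := Real.mul_self_sqrt hQ0.le
          calc M * Real.sqrt Q * (Real.sqrt Q * R) = M * (Real.sqrt Q * Real.sqrt Q) * R := by ring
            _ = M * (Q * R) := by rw [hQQ]; ring
      _ ≤ C * x ^ (3 * ε / 80) * Real.sqrt (l2Sq N β) * (M / (Real.sqrt Q * R)) * Real.sqrt E := by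
          gcongr
  -- conclusion
  have hfin := hstruct.trans (add_le_add (add_le_add hE1 (mul_le_mul_of_nonneg_left hE2 hβ₁0)) h3)
  linarith only [hfin, h12]


/-! ### Inserting Lemma 9: the size of its right-hand side under (12.5) -/

/-- The right-hand side of BFI's Lemma 9 (p. 236) without the constant:
`(CDHR)^η {H² + CDHR + H R^{1/2} (H+R)^{1/2} [D(R²+HR)(D+CR²) + D²CR√(R²+HR) + C²HR³]^{1/2}}`.
[cite: BombieriFriedlanderIwaniecActa1986, §12 Lemma 9 p. 236] -/
def lemma9Rhs (C D H R η : ℝ) : ℝ :=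
  (C * D * H * R) ^ η *
    (H ^ 2 + C * D * H * R + H * R ^ (1 / 2 : ℝ) * (H + R) ^ (1 / 2 : ℝ) *
      (D * (R ^ 2 + H * R) * (D + C * R ^ 2) + D ^ 2 * C * R * (R ^ 2 + H * R) ^ (1 / 2 : ℝ) +
        C ^ 2 * H * R ^ 3) ^ (1 / 2 : ℝ))

set_option maxHeartbeats 800000 in
-- elementary but long exponent bookkeeping (raised heartbeat budget)
/-- **Lemma 9's bound in the range (12.5)** (BFI p. 236–237: "We then have `H < R` and by Lemma 9
`𝓔(2Q,2N,H,2R) ≪ x^ε{Q²R²NM⁻¹ + QR²M⁻¹[QNR⁴ + QN²R² + Q³R⁴M⁻¹]^{1/2}}`. Hence, by (12.2) we get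
(12.4) … provided (12.3) and `x^εQR⁴ < xM`, `x^εQR² < M²`, and `x^εQ³R⁴ < x²M`"): with
`ε₁ = ε/10`, `η = ε₁/40`, `H₀ = ⌊x^{2ε₁}QR/M⌋ ≥ 1` and the four conditions (12.5) (with `x^ε`,
`ε = 10ε₁`), `lemma9Rhs(2Q, 2N, H₀, 2R, η) ≤ 1500 x^{1−ε₁} QR²/M`.
[cite: BombieriFriedlanderIwaniecActa1986, §12 p. 236–237] -/
theorem lemma9Rhs_le {x M N Q R ε₁ : ℝ} (hx : 1 ≤ x) (hMN : M * N = x) (hN1 : 1 ≤ N) (hM1 : 1 ≤ M)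
    (hQ : 1 / 2 ≤ Q) (hR : 1 / 2 ≤ R) (hQR : Q * R < x) (hε₁ : 0 < ε₁) (hε₁1 : ε₁ ≤ 1 / 10)
    (h1 : x ^ (10 * ε₁) * Q < M) (h2 : x ^ (10 * ε₁) * (x⁻¹ * Q * R ^ 4) < M)
    (h3 : x ^ (10 * ε₁) * (Q ^ (1 / 2 : ℝ) * R) < M)
    (h4 : x ^ (10 * ε₁) * (x ^ (-2 : ℝ) * Q ^ 3 * R ^ 4) < M)
    (hH₀ : 1 ≤ ⌊x ^ (2 * ε₁) * Q * R / M⌋₊) :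
    lemma9Rhs (2 * Q) (2 * N) (⌊x ^ (2 * ε₁) * Q * R / M⌋₊ : ℕ) (2 * R) (ε₁ / 40) ≤
      1500 * (x ^ (1 - ε₁) * Q * R ^ 2 / M) := by
  have hx0 : 0 < x := by linarith
  have hM0 : 0 < M := by linarith
  have hN0 : 0 < N := by linarith
  have hQ0 : 0 < Q := by linarith
  have hR0 : 0 < R := by linarith
  have hMx : M ≤ x := by
    rw [← hMN]; exact le_mul_of_one_le_right hM0.le hN1
  have hNeq : N = x / M := by rw [← hMN]; field_simp
  -- `H₀ ≤ H = x^{2ε₁} Q R / M`, and the basic consequences of (12.5)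
  set H : ℝ := x ^ (2 * ε₁) * Q * R / M with hHdef
  have hH0 : 0 ≤ H := by positivity
  set h : ℝ := ((⌊H⌋₊ : ℕ) : ℝ) with hhdef
  have hhH : h ≤ H := Nat.floor_le hH0
  have hh1 : 1 ≤ h := by rw [hhdef]; exact_mod_cast hH₀
  have hh0 : 0 < h := by linarith
  -- `Q/M < x^{-10ε₁}`
  have hQM : Q < x ^ (-(10 * ε₁)) * M := by
    rw [Real.rpow_neg hx0.le, ← div_eq_inv_mul, lt_div_iff₀ (by positivity)]
    linarith
  -- `H ≤ x^{-8ε₁} R ≤ R`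
  have hHR : H ≤ x ^ (-(8 * ε₁)) * R := by
    rw [hHdef, div_le_iff₀ hM0]
    have e : x ^ (-(8 * ε₁)) * R * M = x ^ (2 * ε₁) * R * (x ^ (-(10 * ε₁)) * M) := by
      rw [show -(8 * ε₁) = 2 * ε₁ + -(10 * ε₁) by ring, Real.rpow_add hx0]; ring
    rw [e]
    have : x ^ (2 * ε₁) * Q * R = x ^ (2 * ε₁) * R * Q := by ring
    rw [this]
    exact mul_le_mul_of_nonneg_left hQM.le (by positivity)
  have hxle1 : ∀ t : ℝ, 0 ≤ t → x ^ (-t) ≤ 1 := fun t ht =>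
    Real.rpow_le_one_of_one_le_of_nonpos hx (by linarith)
  have hHR' : H ≤ R := hHR.trans (mul_le_of_le_one_left hR0.le (hxle1 _ (by positivity)))
  have hhR : h ≤ R := hhH.trans hHR'
  -- the prefactor `(2Q·2N·h·2R)^η ≤ 32 x^{ε₁/8}`
  have hP : (2 * Q * (2 * N) * h * (2 * R)) ^ (ε₁ / 40) ≤ 32 * x ^ (ε₁ / 8) := by
    have hQx : Q ≤ 2 * x := by
      calc Q = Q * 1 := (mul_one Q).symm
        _ ≤ Q * (2 * R) := mul_le_mul_of_nonneg_left (by linarith) hQ0.le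
        _ = 2 * (Q * R) := by ring
        _ ≤ 2 * x := by linarith
    have hRx : R ≤ 2 * x := by
      calc R = 1 * R := (one_mul R).symm
        _ ≤ (2 * Q) * R := mul_le_mul_of_nonneg_right (by linarith) hR0.le
        _ = 2 * (Q * R) := by ring
        _ ≤ 2 * x := by linarith
    have hNx : N ≤ x := by rw [hNeq]; exact div_le_self hx0.le hM1
    have hhx : h ≤ x ^ (2 : ℝ) := by
      refine hhH.trans ?_
      rw [hHdef, div_le_iff₀ hM0]
      calc x ^ (2 * ε₁) * Q * R = x ^ (2 * ε₁) * (Q * R) := by ring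
        _ ≤ x ^ (1 : ℝ) * x := by
            refine mul_le_mul (Real.rpow_le_rpow_of_exponent_le hx (by linarith)) hQR.le
              (by positivity) (by positivity)
        _ = x ^ (2 : ℝ) * 1 := by rw [Real.rpow_one, Real.rpow_two]; ring
        _ ≤ x ^ (2 : ℝ) * M := mul_le_mul_of_nonneg_left hM1 (by positivity)
    have hPle : 2 * Q * (2 * N) * h * (2 * R) ≤ 32 * x ^ (5 : ℝ) := by
      calc 2 * Q * (2 * N) * h * (2 * R) ≤ 2 * (2 * x) * (2 * x) * x ^ (2 : ℝ) * (2 * (2 * x)) := by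
            gcongr
        _ = 32 * (x * x * x * x ^ (2 : ℝ)) := by ring
        _ = 32 * x ^ (5 : ℝ) := by
            rw [Real.rpow_two, show (5 : ℝ) = ((5 : ℕ) : ℝ) by norm_num, Real.rpow_natCast]; ring
    calc (2 * Q * (2 * N) * h * (2 * R)) ^ (ε₁ / 40) ≤ (32 * x ^ (5 : ℝ)) ^ (ε₁ / 40) :=
          Real.rpow_le_rpow (by positivity) hPle (by positivity)
      _ = (32 : ℝ) ^ (ε₁ / 40) * x ^ (ε₁ / 8) := by
          rw [Real.mul_rpow (by norm_num) (by positivity), ← Real.rpow_mul hx0.le]; ring_nf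
      _ ≤ 32 * x ^ (ε₁ / 8) := by
          refine mul_le_mul_of_nonneg_right ?_ (by positivity)
          calc (32 : ℝ) ^ (ε₁ / 40) ≤ (32 : ℝ) ^ (1 : ℝ) :=
                Real.rpow_le_rpow_of_exponent_le (by norm_num) (by linarith)
            _ = 32 := Real.rpow_one _
  -- target scale
  set W : ℝ := x ^ (1 - ε₁) * Q * R ^ 2 / M with hWdef
  have hW0 : 0 < W := by positivity
  -- `H · (Q/M) ...`: the monomial `x^{2ε₁} Q R²/M · (something)` form of `h²` and `CDhR`
  have hT1 : h ^ 2 ≤ x ^ (-(6 * ε₁)) * (Q * R ^ 2 / M) := by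
    calc h ^ 2 ≤ H * H := by rw [sq]; exact mul_le_mul hhH hhH hh0.le hH0
      _ ≤ H * (x ^ (-(8 * ε₁)) * R) := mul_le_mul_of_nonneg_left hHR hH0
      _ = x ^ (2 * ε₁) * x ^ (-(8 * ε₁)) * (Q * R ^ 2 / M) := by rw [hHdef]; ring
      _ = x ^ (-(6 * ε₁)) * (Q * R ^ 2 / M) := by
          rw [← Real.rpow_add hx0]; ring_nf
  have hT2 : 2 * Q * (2 * N) * h * (2 * R) ≤ 8 * x ^ (1 - 8 * ε₁) * (Q * R ^ 2 / M) := by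
    calc 2 * Q * (2 * N) * h * (2 * R) ≤ 2 * Q * (2 * N) * H * (2 * R) := by gcongr
      _ = 8 * x ^ (2 * ε₁) * (Q * R ^ 2 / M) * (N * Q) := by rw [hHdef]; ring
      _ ≤ 8 * x ^ (2 * ε₁) * (Q * R ^ 2 / M) * (N * (x ^ (-(10 * ε₁)) * M)) := by
          gcongr
      _ = 8 * (x ^ (2 * ε₁) * x ^ (-(10 * ε₁)) * (M * N)) * (Q * R ^ 2 / M) := by ring
      _ = 8 * x ^ (1 - 8 * ε₁) * (Q * R ^ 2 / M) := by
          rw [hMN, ← Real.rpow_add hx0, show (1 - 8 * ε₁) = (2 * ε₁ + -(10 * ε₁)) + 1 by ring,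
            Real.rpow_add hx0 _ 1, Real.rpow_one]
  -- the bracket
  have hRlt : R < Real.sqrt 2 * x ^ (-(10 * ε₁)) * M := by
    have hQ2 : 1 ≤ Real.sqrt 2 * Q ^ (1 / 2 : ℝ) := by
      rw [← Real.sqrt_eq_rpow, ← Real.sqrt_mul (by norm_num)]
      rw [Real.le_sqrt (by norm_num) (by positivity)]
      linarith
    have h3' : Q ^ (1 / 2 : ℝ) * R < x ^ (-(10 * ε₁)) * M := by
      rw [Real.rpow_neg hx0.le, ← div_eq_inv_mul, lt_div_iff₀ (by positivity)]
      linarith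
    calc R = 1 * R := (one_mul R).symm
      _ ≤ (Real.sqrt 2 * Q ^ (1 / 2 : ℝ)) * R := mul_le_mul_of_nonneg_right hQ2 hR0.le
      _ = Real.sqrt 2 * (Q ^ (1 / 2 : ℝ) * R) := by ring
      _ < Real.sqrt 2 * (x ^ (-(10 * ε₁)) * M) := mul_lt_mul_of_pos_left h3' (by positivity)
      _ = _ := by ring
  have hx2pow : ∀ t : ℝ, (x ^ (-t) * M) * N = x ^ (1 - t) := by
    intro t
    rw [mul_assoc, hMN, show (1 - t) = -t + 1 by ring, Real.rpow_add hx0, Real.rpow_one]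
  have hpow2 : ∀ t : ℝ, (x ^ t) ^ 2 = x ^ (2 * t) := fun t => by
    rw [sq, ← Real.rpow_add hx0]; ring_nf
  have hxmono : ∀ s t : ℝ, s ≤ t → x ^ s ≤ x ^ t := fun s t hst =>
    Real.rpow_le_rpow_of_exponent_le hx hst
  -- the four monomials of the bracket
  have hB1 : N ^ 2 * R ^ 2 ≤ 2 * x ^ (2 - 25 * ε₁ / 4) := by
    have hNR : N * R ≤ Real.sqrt 2 * x ^ (1 - 10 * ε₁) := by
      calc N * R ≤ N * (Real.sqrt 2 * x ^ (-(10 * ε₁)) * M) :=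
            mul_le_mul_of_nonneg_left hRlt.le hN0.le
        _ = Real.sqrt 2 * ((x ^ (-(10 * ε₁)) * M) * N) := by ring
        _ = Real.sqrt 2 * x ^ (1 - 10 * ε₁) := by rw [hx2pow]
    calc N ^ 2 * R ^ 2 = (N * R) ^ 2 := by ring
      _ ≤ (Real.sqrt 2 * x ^ (1 - 10 * ε₁)) ^ 2 := pow_le_pow_left₀ (by positivity) hNR 2
      _ = 2 * x ^ (2 * (1 - 10 * ε₁)) := by rw [mul_pow, Real.sq_sqrt (by norm_num), hpow2]
      _ ≤ 2 * x ^ (2 - 25 * ε₁ / 4) :=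
          mul_le_mul_of_nonneg_left (hxmono _ _ (by linarith)) (by norm_num)
  have hB2 : N * Q * R ^ 4 ≤ x ^ (2 - 25 * ε₁ / 4) := by
    have e : Q * R ^ 4 = x ^ (1 - 10 * ε₁) * (x ^ (10 * ε₁) * (x⁻¹ * Q * R ^ 4)) := by
      rw [← mul_assoc, ← Real.rpow_add hx0, show 1 - 10 * ε₁ + 10 * ε₁ = 1 by ring, Real.rpow_one]
      field_simp
    have hQR4 : Q * R ^ 4 ≤ x ^ (1 - 10 * ε₁) * M := by
      rw [e]; exact (mul_lt_mul_of_pos_left h2 (by positivity)).le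
    calc N * Q * R ^ 4 = (Q * R ^ 4) * N := by ring
      _ ≤ (x ^ (1 - 10 * ε₁) * M) * N := mul_le_mul_of_nonneg_right hQR4 hN0.le
      _ = x ^ (1 - 10 * ε₁) * x := by rw [mul_assoc, hMN]
      _ = x ^ (2 - 10 * ε₁) := by
          rw [show (2 - 10 * ε₁) = (1 - 10 * ε₁) + 1 by ring, Real.rpow_add hx0, Real.rpow_one]
      _ ≤ x ^ (2 - 25 * ε₁ / 4) := hxmono _ _ (by linarith)
  have hB3 : N ^ 2 * Q * R ^ 2 ≤ x ^ (2 - 25 * ε₁ / 4) := by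
    have h3' : Q ^ (1 / 2 : ℝ) * R ≤ x ^ (-(10 * ε₁)) * M := by
      rw [Real.rpow_neg hx0.le, ← div_eq_inv_mul, le_div_iff₀ (by positivity)]
      linarith
    have hsqQ : (Q ^ (1 / 2 : ℝ)) ^ 2 = Q := by
      rw [← Real.sqrt_eq_rpow, Real.sq_sqrt hQ0.le]
    calc N ^ 2 * Q * R ^ 2 = ((Q ^ (1 / 2 : ℝ) * R) * N) ^ 2 := by rw [mul_pow, mul_pow, hsqQ]; ring
      _ ≤ ((x ^ (-(10 * ε₁)) * M) * N) ^ 2 :=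
          pow_le_pow_left₀ (by positivity) (mul_le_mul_of_nonneg_right h3' hN0.le) 2
      _ = x ^ (2 * (1 - 10 * ε₁)) := by rw [hx2pow, hpow2]
      _ ≤ x ^ (2 - 25 * ε₁ / 4) := hxmono _ _ (by linarith)
  have hB4 : x ^ (2 * ε₁) * Q ^ 3 * R ^ 4 / M ≤ x ^ (2 - 25 * ε₁ / 4) := by
    have e : Q ^ 3 * R ^ 4 = x ^ (2 - 10 * ε₁) * (x ^ (10 * ε₁) * (x ^ (-2 : ℝ) * Q ^ 3 * R ^ 4)) := by
      rw [← mul_assoc, ← Real.rpow_add hx0, ← mul_assoc, ← mul_assoc, ← Real.rpow_add hx0,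
        show 2 - 10 * ε₁ + 10 * ε₁ + -2 = 0 by ring, Real.rpow_zero, one_mul]
    have hQ3 : Q ^ 3 * R ^ 4 ≤ x ^ (2 - 10 * ε₁) * M := by
      rw [e]; exact (mul_lt_mul_of_pos_left h4 (by positivity)).le
    rw [div_le_iff₀ hM0]
    calc x ^ (2 * ε₁) * Q ^ 3 * R ^ 4 = x ^ (2 * ε₁) * (Q ^ 3 * R ^ 4) := by ring
      _ ≤ x ^ (2 * ε₁) * (x ^ (2 - 10 * ε₁) * M) := mul_le_mul_of_nonneg_left hQ3 (by positivity)
      _ = x ^ (2 - 8 * ε₁) * M := by rw [← mul_assoc, ← Real.rpow_add hx0]; ring_nf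
      _ ≤ x ^ (2 - 25 * ε₁ / 4) * M := mul_le_mul_of_nonneg_right (hxmono _ _ (by linarith)) hM0.le
  -- the bracket `Br ≤ 216 x^{2 - 25ε₁/4}`
  have hRR : (2 * R) ^ 2 + h * (2 * R) ≤ 6 * R ^ 2 := by nlinarith [hhR, hR0, hh0]
  have hsq6 : Real.sqrt ((2 * R) ^ 2 + h * (2 * R)) ≤ 5 / 2 * R := by
    calc Real.sqrt ((2 * R) ^ 2 + h * (2 * R)) ≤ Real.sqrt ((5 / 2 * R) ^ 2) :=
          Real.sqrt_le_sqrt (by nlinarith)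
      _ = 5 / 2 * R := Real.sqrt_sq (by positivity)
  have hQRH : (2 * Q) ^ 2 * h * (2 * R) ^ 3 ≤ 32 * (x ^ (2 * ε₁) * Q ^ 3 * R ^ 4 / M) := by
    calc (2 * Q) ^ 2 * h * (2 * R) ^ 3 ≤ (2 * Q) ^ 2 * H * (2 * R) ^ 3 := by gcongr
      _ = 32 * (x ^ (2 * ε₁) * Q ^ 3 * R ^ 4 / M) := by rw [hHdef]; ring
  have hBr : 2 * N * ((2 * R) ^ 2 + h * (2 * R)) * (2 * N + 2 * Q * (2 * R) ^ 2) +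
      (2 * N) ^ 2 * (2 * Q) * (2 * R) * Real.sqrt ((2 * R) ^ 2 + h * (2 * R)) +
        (2 * Q) ^ 2 * h * (2 * R) ^ 3 ≤ 216 * x ^ (2 - 25 * ε₁ / 4) := by
    have s1 : 2 * N * ((2 * R) ^ 2 + h * (2 * R)) * (2 * N + 2 * Q * (2 * R) ^ 2) ≤
        24 * (N ^ 2 * R ^ 2) + 96 * (N * Q * R ^ 4) := by
      calc 2 * N * ((2 * R) ^ 2 + h * (2 * R)) * (2 * N + 2 * Q * (2 * R) ^ 2)
          ≤ 2 * N * (6 * R ^ 2) * (2 * N + 2 * Q * (2 * R) ^ 2) := by gcongr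
        _ = 24 * (N ^ 2 * R ^ 2) + 96 * (N * Q * R ^ 4) := by ring
    have s2 : (2 * N) ^ 2 * (2 * Q) * (2 * R) * Real.sqrt ((2 * R) ^ 2 + h * (2 * R)) ≤
        40 * (N ^ 2 * Q * R ^ 2) := by
      calc (2 * N) ^ 2 * (2 * Q) * (2 * R) * Real.sqrt ((2 * R) ^ 2 + h * (2 * R))
          ≤ (2 * N) ^ 2 * (2 * Q) * (2 * R) * (5 / 2 * R) := by gcongr
        _ = 40 * (N ^ 2 * Q * R ^ 2) := by ring
    linarith [hB1, hB2, hB3, hB4, hQRH, s1, s2]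
  -- `T₃ ≤ (75/2) x^{1 - 9ε₁/8} (Q R²/M)`
  have hT3 : h * (2 * R) ^ (1 / 2 : ℝ) * (h + 2 * R) ^ (1 / 2 : ℝ) *
      (2 * N * ((2 * R) ^ 2 + h * (2 * R)) * (2 * N + 2 * Q * (2 * R) ^ 2) +
        (2 * N) ^ 2 * (2 * Q) * (2 * R) * ((2 * R) ^ 2 + h * (2 * R)) ^ (1 / 2 : ℝ) +
          (2 * Q) ^ 2 * h * (2 * R) ^ 3) ^ (1 / 2 : ℝ) ≤
      75 / 2 * x ^ (1 - 9 * ε₁ / 8) * (Q * R ^ 2 / M) := by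
    simp only [← Real.sqrt_eq_rpow]
    have hsr : Real.sqrt (2 * R) * Real.sqrt (h + 2 * R) ≤ 5 / 2 * R := by
      rw [← Real.sqrt_mul (by positivity)]
      calc Real.sqrt (2 * R * (h + 2 * R)) ≤ Real.sqrt ((5 / 2 * R) ^ 2) :=
            Real.sqrt_le_sqrt (by nlinarith [hhR, hR0, hh0])
        _ = 5 / 2 * R := Real.sqrt_sq (by positivity)
    have hsBr : Real.sqrt (2 * N * ((2 * R) ^ 2 + h * (2 * R)) * (2 * N + 2 * Q * (2 * R) ^ 2) +
        (2 * N) ^ 2 * (2 * Q) * (2 * R) * Real.sqrt ((2 * R) ^ 2 + h * (2 * R)) +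
          (2 * Q) ^ 2 * h * (2 * R) ^ 3) ≤ 15 * x ^ (1 - 25 * ε₁ / 8) := by
      calc _ ≤ Real.sqrt (216 * x ^ (2 - 25 * ε₁ / 4)) := Real.sqrt_le_sqrt hBr
        _ ≤ Real.sqrt ((15 * x ^ (1 - 25 * ε₁ / 8)) ^ 2) := by
            refine Real.sqrt_le_sqrt ?_
            rw [mul_pow, hpow2]
            have : x ^ (2 - 25 * ε₁ / 4) = x ^ (2 * (1 - 25 * ε₁ / 8)) := by ring_nf
            rw [this]
            nlinarith [Real.rpow_nonneg hx0.le (2 * (1 - 25 * ε₁ / 8))]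
        _ = 15 * x ^ (1 - 25 * ε₁ / 8) := Real.sqrt_sq (by positivity)
    have h0Br : 0 ≤ Real.sqrt (2 * N * ((2 * R) ^ 2 + h * (2 * R)) * (2 * N + 2 * Q * (2 * R) ^ 2) +
        (2 * N) ^ 2 * (2 * Q) * (2 * R) * Real.sqrt ((2 * R) ^ 2 + h * (2 * R)) +
          (2 * Q) ^ 2 * h * (2 * R) ^ 3) := Real.sqrt_nonneg _
    calc h * Real.sqrt (2 * R) * Real.sqrt (h + 2 * R) *
          Real.sqrt (2 * N * ((2 * R) ^ 2 + h * (2 * R)) * (2 * N + 2 * Q * (2 * R) ^ 2) +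
            (2 * N) ^ 2 * (2 * Q) * (2 * R) * Real.sqrt ((2 * R) ^ 2 + h * (2 * R)) +
              (2 * Q) ^ 2 * h * (2 * R) ^ 3)
        = h * (Real.sqrt (2 * R) * Real.sqrt (h + 2 * R)) *
          Real.sqrt (2 * N * ((2 * R) ^ 2 + h * (2 * R)) * (2 * N + 2 * Q * (2 * R) ^ 2) +
            (2 * N) ^ 2 * (2 * Q) * (2 * R) * Real.sqrt ((2 * R) ^ 2 + h * (2 * R)) +
              (2 * Q) ^ 2 * h * (2 * R) ^ 3) := by ring
      _ ≤ H * (5 / 2 * R) * (15 * x ^ (1 - 25 * ε₁ / 8)) := by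
          refine mul_le_mul (mul_le_mul hhH hsr (by positivity) hH0) hsBr h0Br (by positivity)
      _ = 75 / 2 * (x ^ (2 * ε₁) * x ^ (1 - 25 * ε₁ / 8)) * (Q * R ^ 2 / M) := by rw [hHdef]; ring
      _ = 75 / 2 * x ^ (1 - 9 * ε₁ / 8) * (Q * R ^ 2 / M) := by
          rw [← Real.rpow_add hx0]; ring_nf
  -- everything together
  have hsum : h ^ 2 + 2 * Q * (2 * N) * h * (2 * R) +
      h * (2 * R) ^ (1 / 2 : ℝ) * (h + 2 * R) ^ (1 / 2 : ℝ) *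
        (2 * N * ((2 * R) ^ 2 + h * (2 * R)) * (2 * N + 2 * Q * (2 * R) ^ 2) +
          (2 * N) ^ 2 * (2 * Q) * (2 * R) * ((2 * R) ^ 2 + h * (2 * R)) ^ (1 / 2 : ℝ) +
            (2 * Q) ^ 2 * h * (2 * R) ^ 3) ^ (1 / 2 : ℝ) ≤
      (93 / 2) * x ^ (1 - 9 * ε₁ / 8) * (Q * R ^ 2 / M) := by
    have e1 : x ^ (-(6 * ε₁)) * (Q * R ^ 2 / M) ≤ x ^ (1 - 9 * ε₁ / 8) * (Q * R ^ 2 / M) :=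
      mul_le_mul_of_nonneg_right (hxmono _ _ (by linarith)) (by positivity)
    have e2 : 8 * x ^ (1 - 8 * ε₁) * (Q * R ^ 2 / M) ≤ 8 * x ^ (1 - 9 * ε₁ / 8) * (Q * R ^ 2 / M) := by
      refine mul_le_mul_of_nonneg_right (mul_le_mul_of_nonneg_left (hxmono _ _ ?_) (by norm_num))
        (by positivity)
      linarith
    linarith [hT1, hT2, hT3, e1, e2]
  have hsum0 : 0 ≤ h ^ 2 + 2 * Q * (2 * N) * h * (2 * R) +
      h * (2 * R) ^ (1 / 2 : ℝ) * (h + 2 * R) ^ (1 / 2 : ℝ) *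
        (2 * N * ((2 * R) ^ 2 + h * (2 * R)) * (2 * N + 2 * Q * (2 * R) ^ 2) +
          (2 * N) ^ 2 * (2 * Q) * (2 * R) * ((2 * R) ^ 2 + h * (2 * R)) ^ (1 / 2 : ℝ) +
            (2 * Q) ^ 2 * h * (2 * R) ^ 3) ^ (1 / 2 : ℝ) := by positivity
  unfold lemma9Rhs
  calc _ ≤ (32 * x ^ (ε₁ / 8)) * ((93 / 2) * x ^ (1 - 9 * ε₁ / 8) * (Q * R ^ 2 / M)) :=
        mul_le_mul hP hsum hsum0 (by positivity)
    _ = 1488 * ((x ^ (ε₁ / 8) * x ^ (1 - 9 * ε₁ / 8)) * Q * R ^ 2 / M) := by ring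
    _ = 1488 * (x ^ (1 - ε₁) * Q * R ^ 2 / M) := by
        rw [← Real.rpow_add hx0]; ring_nf
    _ ≤ 1500 * (x ^ (1 - ε₁) * Q * R ^ 2 / M) := by
        nlinarith [hW0]


/-- `lemma9Rhs ≥ 0` for nonnegative arguments. [folklore] -/
theorem lemma9Rhs_nonneg {C D H R : ℝ} (hC : 0 ≤ C) (hD : 0 ≤ D) (hH : 0 ≤ H) (hR : 0 ≤ R) (η : ℝ) :
    0 ≤ lemma9Rhs C D H R η := by
  unfold lemma9Rhs
  positivity


/-! ### Theorem 5 from a bound for `𝓔` in the range (12.5) -/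

set_option maxHeartbeats 800000 in
-- the final assembly (raised heartbeat budget)
/-- **Theorem 5 from any admissible bound for `𝓔`.**  If for every `a ≠ 0` and `0 < ε₁ ≤ 1/10`
there is `K` such that, in the regime of Theorem 5 (`x ≥ 1`, `MN = x`, `M, N ≥ 1`, `Q, R ≥ 1/2`,
`QR < x`, the four conditions (12.5) with `x^{10ε₁}`, and `H₀ = ⌊x^{2ε₁}QR/M⌋ ≥ 1`),
`𝓔(2Q, 2N, H₀, 2R; δ') ≤ K · x^{1−ε₁} QR²/M` for all `|δ'| ≤ 1`, then the named fact
`BombieriFriedlanderIwaniecTheorem5` holds (with `ε' = min(ε,1)/80`).  This is the end of BFI's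
§12 (p. 236–237) with the input bound for `𝓔` abstracted; `BombieriFriedlanderIwaniecTheorem5_of_lemma9`
feeds it with Lemma 9 through `lemma9Rhs_le`. [cite: BombieriFriedlanderIwaniecActa1986, §12 Theorem 5 p. 237] -/
theorem theorem5_of_dispE_bound
    (hE : ∀ a : ℤ, a ≠ 0 → ∀ ε₁ : ℝ, 0 < ε₁ → ε₁ ≤ 1 / 10 → ∃ K : ℝ, ∀ x M N Q R : ℝ,
      1 ≤ x → M * N = x → 1 ≤ N → 1 ≤ M → 1 / 2 ≤ Q → 1 / 2 ≤ R → Q * R < x →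
      x ^ (10 * ε₁) * Q < M → x ^ (10 * ε₁) * (x⁻¹ * Q * R ^ 4) < M →
      x ^ (10 * ε₁) * (Q ^ (1 / 2 : ℝ) * R) < M →
      x ^ (10 * ε₁) * (x ^ (-2 : ℝ) * Q ^ 3 * R ^ 4) < M →
      1 ≤ ⌊x ^ (2 * ε₁) * Q * R / M⌋₊ →
      ∀ δ' : ℕ → ℕ → ℂ, (∀ h r, ‖δ' h r‖ ≤ 1) →
        dispE a (2 * Q) (2 * N) (⌊x ^ (2 * ε₁) * Q * R / M⌋₊ : ℕ) (2 * R) δ' ≤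
          K * (x ^ (1 - ε₁) * Q * R ^ 2 / M)) :
    BombieriFriedlanderIwaniecTheorem5 := by
  intro a ha ε hε B hB
  -- work with `ε₀ = min ε 1`
  obtain ⟨ε₀, hε₀def⟩ : ∃ ε₀ : ℝ, ε₀ = min ε 1 := ⟨_, rfl⟩
  have hε₀ : 0 < ε₀ := by rw [hε₀def]; exact lt_min hε one_pos
  have hε₀1 : ε₀ ≤ 1 := by rw [hε₀def]; exact min_le_right _ _
  have hε₀ε : ε₀ ≤ ε := by rw [hε₀def]; exact min_le_left _ _
  obtain ⟨C₁, x₁, hC₁, h12⟩ := abs_dispD_one_le_asymptotic a hε₀ hε₀1 hB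
  obtain ⟨K, hK⟩ := hE a ha (ε₀ / 10) (by positivity) (by linarith)
  obtain ⟨K', hK'def⟩ : ∃ K' : ℝ, K' = max K 1 := ⟨_, rfl⟩
  have hK'1 : 1 ≤ K' := by rw [hK'def]; exact le_max_right _ _
  have hKle : K ≤ K' := by rw [hK'def]; exact le_max_left _ _
  refine ⟨ε₀ / 80, C₁ + C₁ * Real.sqrt K', max x₁ 1, by positivity, ?_⟩
  intro x hx M N Q R hMN hN1 hN2 hQ hR hQR hthr β γ δ hγ hδ
  have hx1 : 1 ≤ x := le_trans (le_max_right _ _) hx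
  have hxx₁ : x₁ ≤ x := le_trans (le_max_left _ _) hx
  have hx0 : 0 < x := by linarith
  have hQ0 : 0 < Q := by linarith
  have hR0 : 0 < R := by linarith
  -- the hypotheses with `ε₀`
  have hN1' : x ^ ε₀ ≤ N := le_trans (Real.rpow_le_rpow_of_exponent_le hx1 hε₀ε) hN1
  have hN2' : N ≤ x ^ (1 - ε₀) := hN2.trans (Real.rpow_le_rpow_of_exponent_le hx1 (by linarith))
  have hN1'' : 1 ≤ N := le_trans (Real.one_le_rpow hx1 hε₀.le) hN1'
  have hN0 : 0 < N := by linarith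
  have hMeq : M = x / N := by rw [← hMN]; field_simp
  have hMε : x ^ ε₀ ≤ M := by
    rw [hMeq, le_div_iff₀ hN0]
    calc x ^ ε₀ * N ≤ x ^ ε₀ * x ^ (1 - ε₀) := mul_le_mul_of_nonneg_left hN2' (by positivity)
      _ = x := by rw [← Real.rpow_add hx0]; norm_num
  have hM1 : 1 ≤ M := le_trans (Real.one_le_rpow hx1 hε₀.le) hMε
  have hM0 : 0 < M := by linarith
  set S : ℝ := Real.sqrt (l2Sq N β) with hSdef
  have hS0 : 0 ≤ S := Real.sqrt_nonneg _
  -- the first term of (12.2) against the target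
  have hfirst : C₁ * S * x ^ (1 / 2 - ε₀ / 20) * M ^ (1 / 2 : ℝ) ≤
      C₁ * S * x ^ (1 / 2 - ε₀ / 80) * M ^ (1 / 2 : ℝ) := by
    have : x ^ (1 / 2 - ε₀ / 20) ≤ x ^ (1 / 2 - ε₀ / 80) :=
      Real.rpow_le_rpow_of_exponent_le hx1 (by linarith)
    gcongr
  have htarget0 : 0 ≤ C₁ * Real.sqrt K' * S * x ^ (1 / 2 - ε₀ / 80) * M ^ (1 / 2 : ℝ) := by
    positivity
  -- `H₀`
  obtain ⟨H₀, hH₀def⟩ : ∃ H₀ : ℕ, H₀ = ⌊x ^ (2 * (ε₀ / 10)) * Q * R / M⌋₊ := ⟨_, rfl⟩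
  rcases Nat.eq_zero_or_pos H₀ with hH0 | hHpos
  · -- no frequencies: `E = 0`
    have hE0 : ∀ δ' : ℕ → ℕ → ℂ, (∀ h r, ‖δ' h r‖ ≤ 1) →
        dispE a (2 * Q) (2 * N) (⌊x ^ (2 * (ε₀ / 10)) * Q * R / M⌋₊ : ℕ) (2 * R) δ' ≤ 0 := by
      intro δ' _
      rw [← hH₀def, hH0, dispE_eq_zero_of_floor (by simp)]
    have h := h12 x hxx₁ M N Q R hMN hN1' hN2' hQ hR hQR β γ δ hγ hδ 0 hE0
    rw [Real.sqrt_zero, mul_zero, add_zero] at h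
    calc |dispD a M N Q R (fun _ => 1) β γ δ| ≤ C₁ * S * x ^ (1 / 2 - ε₀ / 80) * M ^ (1 / 2 : ℝ) :=
          h.trans hfirst
      _ ≤ (C₁ + C₁ * Real.sqrt K') * S * x ^ (1 / 2 - ε₀ / 80) * M ^ (1 / 2 : ℝ) := by
          nlinarith [htarget0]
  · -- `H₀ ≥ 1`: insert the bound for `𝓔`
    -- (12.5) with `ε₀`
    have hthr' : ∀ c : ℝ, 0 ≤ c → c ≤ thm5Threshold x Q R → x ^ (10 * (ε₀ / 10)) * c < M := by
      intro c hc0 hc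
      have e : 10 * (ε₀ / 10) = ε₀ := by ring
      rw [e]
      calc x ^ ε₀ * c ≤ x ^ ε * c :=
            mul_le_mul_of_nonneg_right (Real.rpow_le_rpow_of_exponent_le hx1 hε₀ε) hc0
        _ ≤ x ^ ε * thm5Threshold x Q R := mul_le_mul_of_nonneg_left hc (by positivity)
        _ < M := hthr
    have h1 : x ^ (10 * (ε₀ / 10)) * Q < M :=
      hthr' Q hQ0.le (le_trans (le_max_left _ _) (le_max_left _ _))
    have h2 : x ^ (10 * (ε₀ / 10)) * (x⁻¹ * Q * R ^ 4) < M :=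
      hthr' _ (by positivity) (le_trans (le_max_right _ _) (le_max_left _ _))
    have h3 : x ^ (10 * (ε₀ / 10)) * (Q ^ (1 / 2 : ℝ) * R) < M :=
      hthr' _ (by positivity) (le_trans (le_max_left _ _) (le_max_right _ _))
    have h4 : x ^ (10 * (ε₀ / 10)) * (x ^ (-2 : ℝ) * Q ^ 3 * R ^ 4) < M :=
      hthr' _ (by positivity) (le_trans (le_max_right _ _) (le_max_right _ _))
    have hHpos' : 1 ≤ ⌊x ^ (2 * (ε₀ / 10)) * Q * R / M⌋₊ := by rw [← hH₀def]; exact hHpos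
    set W : ℝ := x ^ (1 - ε₀ / 10) * Q * R ^ 2 / M with hWdef
    have hW0 : 0 ≤ W := by positivity
    set E : ℝ := K' * W with hEdef
    have hEbd : ∀ δ' : ℕ → ℕ → ℂ, (∀ h r, ‖δ' h r‖ ≤ 1) →
        dispE a (2 * Q) (2 * N) (⌊x ^ (2 * (ε₀ / 10)) * Q * R / M⌋₊ : ℕ) (2 * R) δ' ≤ E := by
      intro δ' hδ'
      have h := hK x M N Q R hx1 hMN hN1'' hM1 hQ hR hQR h1 h2 h3 h4 hHpos' δ' hδ'
      refine h.trans ?_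
      rw [hEdef]
      exact mul_le_mul_of_nonneg_right hKle hW0
    have h := h12 x hxx₁ M N Q R hMN hN1' hN2' hQ hR hQR β γ δ hγ hδ E hEbd
    -- `(M/(√Q R)) √W = √M x^{(1-ε₁)/2}`
    have hgeom : M / (Real.sqrt Q * R) * Real.sqrt W = M ^ (1 / 2 : ℝ) * x ^ ((1 - ε₀ / 10) / 2) := by
      have hpos : 0 ≤ M / (Real.sqrt Q * R) := by positivity
      have e1 : (M / (Real.sqrt Q * R)) ^ 2 * W = M * x ^ (1 - ε₀ / 10) := by
        rw [hWdef, div_pow, mul_pow, Real.sq_sqrt hQ0.le]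
        field_simp
      calc M / (Real.sqrt Q * R) * Real.sqrt W
          = Real.sqrt ((M / (Real.sqrt Q * R)) ^ 2) * Real.sqrt W := by rw [Real.sqrt_sq hpos]
        _ = Real.sqrt ((M / (Real.sqrt Q * R)) ^ 2 * W) := (Real.sqrt_mul (sq_nonneg _) W).symm
        _ = Real.sqrt (M * x ^ (1 - ε₀ / 10)) := by rw [e1]
        _ = M ^ (1 / 2 : ℝ) * x ^ ((1 - ε₀ / 10) / 2) := by
            rw [Real.sqrt_mul hM0.le, Real.sqrt_eq_rpow, Real.sqrt_eq_rpow, ← Real.rpow_mul hx0.le]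
            ring_nf
    -- the `E`-term against the target
    have hsecond : C₁ * x ^ (3 * ε₀ / 80) * S * (M / (Real.sqrt Q * R)) * Real.sqrt E ≤
        C₁ * Real.sqrt K' * S * x ^ (1 / 2 - ε₀ / 80) * M ^ (1 / 2 : ℝ) := by
      have hsE : Real.sqrt E ≤ Real.sqrt K' * Real.sqrt W := by
        rw [← Real.sqrt_mul (by positivity), hEdef]
      calc C₁ * x ^ (3 * ε₀ / 80) * S * (M / (Real.sqrt Q * R)) * Real.sqrt E
          ≤ C₁ * x ^ (3 * ε₀ / 80) * S * (M / (Real.sqrt Q * R)) * (Real.sqrt K' * Real.sqrt W) :=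
            mul_le_mul_of_nonneg_left hsE (by positivity)
        _ = C₁ * Real.sqrt K' * S * (x ^ (3 * ε₀ / 80) *
              (M / (Real.sqrt Q * R) * Real.sqrt W)) := by ring
        _ = C₁ * Real.sqrt K' * S * (x ^ (3 * ε₀ / 80) *
              (M ^ (1 / 2 : ℝ) * x ^ ((1 - ε₀ / 10) / 2))) := by rw [hgeom]
        _ = C₁ * Real.sqrt K' * S * x ^ (1 / 2 - ε₀ / 80) * M ^ (1 / 2 : ℝ) := by
            rw [mul_comm (M ^ (1 / 2 : ℝ)), ← mul_assoc (x ^ (3 * ε₀ / 80)), ← Real.rpow_add hx0]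
            ring_nf
    calc |dispD a M N Q R (fun _ => 1) β γ δ|
        ≤ C₁ * S * x ^ (1 / 2 - ε₀ / 20) * M ^ (1 / 2 : ℝ) +
            C₁ * x ^ (3 * ε₀ / 80) * S * (M / (Real.sqrt Q * R)) * Real.sqrt E := h
      _ ≤ C₁ * S * x ^ (1 / 2 - ε₀ / 80) * M ^ (1 / 2 : ℝ) +
            C₁ * Real.sqrt K' * S * x ^ (1 / 2 - ε₀ / 80) * M ^ (1 / 2 : ℝ) :=
          add_le_add hfirst hsecond
      _ = (C₁ + C₁ * Real.sqrt K') * S * x ^ (1 / 2 - ε₀ / 80) * M ^ (1 / 2 : ℝ) := by ring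

end BFI

open BFI

/-! ### Theorem 5 from Lemma 9 -/

/-- **BFI 1986, Theorem 5, from Lemma 9.**  The hypothesis is BFI's Lemma 9 (§12, p. 236: "Let
`a ≠ 0`, `C, D, H, R ≥ 1`. We then have
`𝓔(C,D,H,R) ≪ (CDHR)^ε {H² + CDHR + HR^{1/2}(H+R)^{1/2}[D(R²+HR)(D+CR²) + D²CR√(R²+HR) + C²HR³]^{1/2}}`
the constant implied in `≪` depending on `ε` and `a` only" — in the source it "easily follows from
Lemma 6", i.e. from the Deshouillers–Iwaniec bounds for sums of Kloosterman sums, Lemma 1), stated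
for `BFI.dispE` and all complex coefficients `|δ(h,r)| ≤ 1`.  The conclusion is the named fact
`BombieriFriedlanderIwaniecTheorem5` exactly as vendored in `BombieriFriedlanderIwaniecDispersion`.
PROVED here from §12 of the source: smoothing (12.1) (`…Theorem5Weights`), Poisson summation
(`…Theorem5Poisson`), separation of variables and Cauchy's inequality (12.2)
(`…Theorem5Reduction`, `BFI.abs_dispD_one_le_asymptotic`), and the range computation (12.3)–(12.5)
(`BFI.lemma9Rhs_le`, `BFI.theorem5_of_dispE_bound`); the saving obtained is `ε' = min(ε,1)/80`.
[cite: BombieriFriedlanderIwaniecActa1986, §12 Theorem 5 p. 237, Lemma 9 p. 236] -/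
theorem BombieriFriedlanderIwaniecTheorem5_of_lemma9
    (h9 : ∀ a : ℤ, a ≠ 0 → ∀ η : ℝ, 0 < η → ∃ C₉ : ℝ, ∀ C D H R : ℝ,
      1 ≤ C → 1 ≤ D → 1 ≤ H → 1 ≤ R → ∀ δ : ℕ → ℕ → ℂ, (∀ h r, ‖δ h r‖ ≤ 1) →
        BFI.dispE a C D H R δ ≤ C₉ * ((C * D * H * R) ^ η *
          (H ^ 2 + C * D * H * R + H * R ^ (1 / 2 : ℝ) * (H + R) ^ (1 / 2 : ℝ) *
            (D * (R ^ 2 + H * R) * (D + C * R ^ 2) + D ^ 2 * C * R * (R ^ 2 + H * R) ^ (1 / 2 : ℝ) +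
              C ^ 2 * H * R ^ 3) ^ (1 / 2 : ℝ)))) :
    BombieriFriedlanderIwaniecTheorem5 := by
  refine theorem5_of_dispE_bound fun a ha ε₁ hε₁ hε₁1 => ?_
  obtain ⟨C₉, hC₉⟩ := h9 a ha (ε₁ / 40) (by positivity)
  refine ⟨max C₉ 1 * 1500, ?_⟩
  intro x M N Q R hx hMN hN1 hM1 hQ hR hQR h1 h2 h3 h4 hH₀ δ' hδ'
  have hH1 : (1 : ℝ) ≤ ((⌊x ^ (2 * ε₁) * Q * R / M⌋₊ : ℕ) : ℝ) := by exact_mod_cast hH₀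
  have hL := lemma9Rhs_le hx hMN hN1 hM1 hQ hR hQR hε₁ hε₁1 h1 h2 h3 h4 hH₀
  have hL0 : 0 ≤ lemma9Rhs (2 * Q) (2 * N) ((⌊x ^ (2 * ε₁) * Q * R / M⌋₊ : ℕ) : ℝ) (2 * R) (ε₁ / 40) :=
    lemma9Rhs_nonneg (by linarith) (by linarith) (by positivity) (by linarith) _
  have h := hC₉ (2 * Q) (2 * N) ((⌊x ^ (2 * ε₁) * Q * R / M⌋₊ : ℕ) : ℝ) (2 * R) (by linarith)
    (by linarith) hH1 (by linarith) δ' hδ'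
  calc BFI.dispE a (2 * Q) (2 * N) ((⌊x ^ (2 * ε₁) * Q * R / M⌋₊ : ℕ) : ℝ) (2 * R) δ'
      ≤ C₉ * lemma9Rhs (2 * Q) (2 * N) ((⌊x ^ (2 * ε₁) * Q * R / M⌋₊ : ℕ) : ℝ) (2 * R) (ε₁ / 40) := h
    _ ≤ max C₉ 1 * lemma9Rhs (2 * Q) (2 * N) ((⌊x ^ (2 * ε₁) * Q * R / M⌋₊ : ℕ) : ℝ) (2 * R)
          (ε₁ / 40) := mul_le_mul_of_nonneg_right (le_max_left _ _) hL0
    _ ≤ max C₉ 1 * (1500 * (x ^ (1 - ε₁) * Q * R ^ 2 / M)) :=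
        mul_le_mul_of_nonneg_left hL (le_trans zero_le_one (le_max_right _ _))
    _ = max C₉ 1 * 1500 * (x ^ (1 - ε₁) * Q * R ^ 2 / M) := by ring

end Literature.NumberTheory.Sieve
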